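import Literature.MathematicalPhysics.QuantumLattice.FermiRG.BGM2006Sec2ShellLineBounds
import Literature.MathematicalPhysics.QuantumLattice.FermiRG.BGM2006Sec2AnisoSupport
import Literature.Analysis.Fourier.FourierDecayFromDerivBounds
import Mathlib.MeasureTheory.Measure.Haar.InnerProductSpace
import HarnessLib

/-!
# Benfatto–Giuliani–Mastropietro 2006, Lemma 2.3 (2.60): decay of the isotropic single-scale
propagators for a scale-dependent dispersion — proof

Topic `Literature/MathematicalPhysics/QuantumLattice/FermiRG`; the third proof file behind the named fact
`BGM2006_Lemma_2_3` of `BGM2006Sec2Setup.lean` (source BGM06 = G. Benfatto, A. Giuliani, V. Mastropietro,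
*Fermi liquid behavior in the 2D Hubbard model at low temperatures*, Ann. Henri Poincaré **7** (2006)
809–898, arXiv:cond-mat/0507686; locators `p00NN:Lnn` = chunk/line of the `lit read` render of the arXiv
TeX), after `BGM2006Sec2ShellSupport` (support geometry, the `N = 0` bound (2.50)) and
`BGM2006Sec2ShellLineBounds` (the pointwise derivative / difference bounds along rescaled lines).

## The printed proof and this file

BGM prove Lemma 2.2 (anisotropic sectors, (2.52)) by "integrating by parts" in the rescaled variables
`k₀ = O(γ^h)`, `k'₁ = O(γ^h)`, `k'₂ = O(γ^{h/2})` — each integration by parts costs the inverse size of the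
variable and the measure of the support is `O(γ^h · γ^h · γ^{h/2})` — and say that Lemma 2.3 (isotropic
sectors, all momentum variables `O(γ^h)`) is "a repetition of the proof" (p0011:L133–L140).  At finite `β`
the `k₀`-integration by parts is a summation by parts producing `d_β(x₀)` ((2.52), via (2.36c)).  Here:

* §1 `bgmSliceFn`/`bgmSliceE2`: at a Matsubara frequency `k₀(j)` the period-cell integrand
  `1_B F_{h,ω}(k₀,·)/D_{h-1}(k₀,·)` is a smooth compactly supported function on the plane
  (`contDiff_bgmSliceE2`, `hasCompactSupport_bgmSliceE2`: on the disc it is the smooth surrogate `γ^{-h}Φ̃`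
  of `BGM2006Sec2ShellLineBounds`, off the small disc it vanishes), its topological support lies in the
  closed window `{c ≤ |q⃗| ≤ π/4, |Re E_h - μ| ≤ e₀γ^h, |q⃗|cos(3w_m/4) ≤ q⃗·e⃗_r(θ_ω)}`
  (`tsupport_bgmSliceE2_subset_window`), its `N`-th directional derivatives are `O(γ^{-h}γ^{-Nh})`
  (`exists_norm_iteratedFDeriv_bgmSliceE2_le`, the line bounds of `BGM2006Sec2ShellLineBounds` read on the
  line `s ↦ x + sv`, `s = γ^hσ`) and have `L¹` norm `O(w_m γ^{-Nh})`
  (`exists_integral_norm_iteratedFDeriv_bgmSliceE2_le`, the polar support lemma of `BGM2006Sec2ShellSupport`).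
* §2 the momentum integral of (2.49) at one frequency is, up to a phase, the Fourier transform of the slice
  (`norm_sliceIntegral_eq_norm_fourier`); `N` integrations by parts in the direction `eᵢ`
  (`Literature.Analysis.Fourier.pow_inner_mul_norm_fourier_le`) give `|xᵢ|^N|∫| ≤ ‖∂ᵢ^N slice‖_{L¹}`
  (`pow_mul_norm_sliceIntegral_le`); summing over the `O(βe₀γ^h)` frequencies of the support,
  `(γ^h|xᵢ|)^N|g| ≤ Kγ^h w_m` (`exists_xpow_mul_norm_bgmGenProp_le`).
* §3 summation by parts in `k₀` (`Literature.Analysis.Fourier.dbeta_pow_mul_norm_matsubara_sum_le`):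
  `(2π/β)^N|d_β(x₀)|^N|Σ_j e^{-ik₀(j)x₀}G_j| ≤ Σ_j|Δ^N G_j|`, the `N`-th Matsubara differences of the slice
  integrals are the integrals of the `N`-th differences of the slices (`fwdDiff_iter_sliceIntegral`), which
  are `O((2π/β)^N γ^{-h}γ^{-Nh})` pointwise (the time export of `BGM2006Sec2ShellLineBounds`, Newton
  interpolation of (2.36c)) on a support of measure `O((N+1) w_m e₀γ^h)` (`norm_integral_fwdDiff_slice_le`);
  with the frequency count, `(γ^h|d_β(x₀)|)^N|g| ≤ Kγ^h w_m` (`exists_dbetapow_mul_norm_bgmGenProp_le`).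
* §4 the three bounds combine to `|g| ≤ Kγ^h w_m/(1 + (γ^h|d_β| + γ^h|x⃗|)^N)` for every angular index `m`
  with `γ^h ≤ w_m` (`exists_decay_bgmGenProp`; the coupled-smallness constant `c₀` of
  `BGM2006Sec2AnisoSupport.exists_coupledSmallness`, `bgmSmoothness_wlog`), and for the isotropic index
  `m = 2n` (`w_m = πγ^h`) this is **`BGM2006_Lemma_2_3_holds : BGM2006_Lemma_2_3`**, (2.60).

Deviation from the printed road: instead of bounding derivatives in the anisotropic frame `(k'₁, k'₂)` we use
pure directional derivatives along the lattice axes with the ISOTROPIC rescaling `γ^h` in both directions —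
this is exactly what (2.60) asks (both components of `x⃗` weighted by `γ^h`), and it makes the angular factor
cost `γ^{-h} ≤ w_m^{-1}` per derivative for every `m` with `γ^h ≤ w_m`; the anisotropic gain of Lemma 2.2
(`k'₂ = O(γ^{h/2})`) is the business of `BGM2006Sec2AnisoSupport`.

Everything here is PROVED; the only definitions are the slice functions `bgmSliceFn`, `bgmSliceE2`.
-/

noncomputable section

open Real Set Filter MeasureTheory Literature.Analysis.Calculus Literature.Analysis.SpecialFunctions
open scoped Topology FourierTransform

namespace Literature.MathematicalPhysics.QuantumLattice.FermiRG

/-! ### §1 The momentum slice at one Matsubara frequency as a smooth compactly supported function -/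

/-- **The period-cell slice integrand** of (2.49) at the frequency `k₀`: `q⃗ ↦ 1_B(q⃗) F_{h,ω}(k₀, q⃗)/D_{h-1}(k₀, q⃗)`
with `B` the disc `|q⃗| < 3π/4` (the translated integration cell sees exactly one copy of the support,
`BGM2006Sec2ShellSupport`). [cite: BenfattoGiulianiMastropietro2006, §2.5 (2.49) p0010:L72] -/
def bgmSliceFn (μ e₀ : ℝ) (E : ℤ → ℝ × (Fin 2 → ℝ) → ℂ) (h : ℤ) (m : ℕ) (ω : ℤ) (k₀ : ℝ)
    (q : Fin 2 → ℝ) : ℂ :=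
  {q : Fin 2 → ℝ | q 0 ^ 2 + q 1 ^ 2 < (3 * π / 4) ^ 2}.indicator
    (fun q => ((bgmSectorFn e₀ μ E h m ω (k₀, q) : ℝ) : ℂ) / bgmDenom μ E (h - 1) (k₀, q)) q

/-- The slice integrand transported to the Euclidean plane `EuclideanSpace ℝ (Fin 2)` (the Fourier side
lives on an inner product space). [cite: BenfattoGiulianiMastropietro2006, §2.5 (2.49) p0010:L72] -/
def bgmSliceE2 (μ e₀ : ℝ) (E : ℤ → ℝ × (Fin 2 → ℝ) → ℂ) (h : ℤ) (m : ℕ) (ω : ℤ) (k₀ : ℝ)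
    (p : EuclideanSpace ℝ (Fin 2)) : ℂ :=
  bgmSliceFn μ e₀ E h m ω k₀ (WithLp.ofLp p)

section Slice

variable {μ e₀ β U c₀ : ℝ} {C : ℕ → ℝ} {hβ : ℤ} {E : ℤ → ℝ × (Fin 2 → ℝ) → ℂ} {h : ℤ}

/-- The coordinates of a point of the disc of radius `r` are `< r` in absolute value. [folklore] -/
private theorem abs_apply_lt_of_sq_add_sq_lt {r : ℝ} (hr : 0 ≤ r) {q : Fin 2 → ℝ} (hq : q 0 ^ 2 + q 1 ^ 2 < r ^ 2)
    (i : Fin 2) : |q i| < r := by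
  have h0 : q 0 ^ 2 < r ^ 2 := by nlinarith [sq_nonneg (q 1)]
  have h1 : q 1 ^ 2 < r ^ 2 := by nlinarith [sq_nonneg (q 0)]
  fin_cases i
  · exact abs_lt_of_sq_lt_sq h0 hr
  · exact abs_lt_of_sq_lt_sq h1 hr

/-- The support of the slice: `1_B F/D ≠ 0` forces `q⃗ ∈ B`, `f_h(k₀, q⃗) ≠ 0` and `ζ(θ(q⃗)) ≠ 0`. [cite: BenfattoGiulianiMastropietro2006, §2.5 (2.49) p0010:L72] -/
theorem bgmSliceFn_ne_zero {m : ℕ} {ω : ℤ} {k₀ : ℝ} {q : Fin 2 → ℝ} (hq : bgmSliceFn μ e₀ E h m ω k₀ q ≠ 0) :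
    q 0 ^ 2 + q 1 ^ 2 < (3 * π / 4) ^ 2 ∧ bgmShell e₀ μ E h (k₀, q) ≠ 0 ∧
      sectorWeightCirc m ω (polarAngle q) ≠ 0 := by
  rw [bgmSliceFn] at hq
  by_cases hB : q ∈ {q : Fin 2 → ℝ | q 0 ^ 2 + q 1 ^ 2 < (3 * π / 4) ^ 2}
  · rw [Set.indicator_of_mem hB] at hq
    refine ⟨hB, fun hf => hq ?_, fun hz => hq ?_⟩
    · simp [bgmSectorFn, hf]
    · simp [bgmSectorFn, hz]
  · exact absurd (Set.indicator_of_notMem hB _) hq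

/-- **The slice through the surrogates**: under (2.36) with the support smallness, at a Matsubara frequency
`1_B F/D = 1_B γ^{-h} Φ̃` with the radial plateau at `c/2`, `c = √((μ+4-e₀)/2)` (the support lies in
`|q⃗| ≥ c`). [cite: BenfattoGiulianiMastropietro2006, §2.5 (2.49) p0010:L72, §2.4 (2.42a) p0010:L9] -/
theorem bgmSliceFn_eq_indicator_surrogate (hI : BGMInitial E) (hS : BGMSmoothness β U C hβ E) (he : 0 < e₀)
    (he4 : e₀ < μ + 4) (hh₁ : hβ ≤ h) (hh₀ : h ≤ 0) (hU : |U| ≤ c₀) (hUh : |U| * |(hβ : ℝ)| ≤ c₀)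
    (hK₀ : |C 0| * c₀ ≤ 3 / 16 * e₀) (hgap' : 2 * |C 0| * c₀ ≤ (μ + 4 - e₀) / 2) (m : ℕ) (ω : ℤ) (j : ℤ)
    (q : Fin 2 → ℝ) :
    bgmSliceFn μ e₀ E h m ω (fermiMatsubara β j) q =
      {q : Fin 2 → ℝ | q 0 ^ 2 + q 1 ^ 2 < (3 * π / 4) ^ 2}.indicator
        (fun q => (((4 : ℝ) ^ (-h) : ℝ) : ℂ) *
          bgmSurrogateIntegrand μ e₀ (Real.sqrt ((μ + 4 - e₀) / 2) / 2) E h m ω (fermiMatsubara β j, q)) q := by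
  have hk₀ : fermiMatsubara β j ∈ matsubaraSet β := ⟨j, rfl⟩
  have hc : 0 < Real.sqrt ((μ + 4 - e₀) / 2) := Real.sqrt_pos.2 (by linarith)
  rw [bgmSliceFn]
  congr 1
  funext q'
  have hη := norm_E_sub_E_le_threshold hS hh₁ hh₀ hUh hK₀ hk₀ q'
  refine sectorIntegrand_eq_bgmSurrogateIntegrand (by positivity) he hη m ω fun hf => ?_
  show Real.sqrt ((μ + 4 - e₀) / 2) / 2 ≤ ‖momToComplex q'‖
  have h1 := lt_sq_add_sq_of_bgmShell_ne_zero (μ := μ) hI hS he hh₁ hh₀ hU hUh hK₀ hf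
  have h2 : (Real.sqrt ((μ + 4 - e₀) / 2)) ^ 2 ≤ ‖momToComplex q'‖ ^ 2 := by
    rw [Real.sq_sqrt (by linarith), norm_momToComplex_sq]; linarith
  have h3 : Real.sqrt ((μ + 4 - e₀) / 2) ≤ ‖momToComplex q'‖ :=
    (pow_le_pow_iff_left₀ hc.le (norm_nonneg _) two_ne_zero).1 h2
  linarith

/-- Off the disc `|q⃗| ≤ π/4` the slice vanishes (the support of `f_h(k₀, ·)` inside `B` lies in
`|q⃗| < π/4`). [cite: BenfattoGiulianiMastropietro2006, §2.5 (2.46)–(2.49) p0010:L55–L75] -/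
theorem bgmSliceFn_eq_zero_of_lt (hI : BGMInitial E) (hS : BGMSmoothness β U C hβ E) (he : 0 < e₀)
    (hh₁ : hβ ≤ h) (hh₀ : h ≤ 0) (hU : |U| ≤ c₀) (hUh : |U| * |(hβ : ℝ)| ≤ c₀) (hμ₁ : -4 < μ)
    (hK₀ : |C 0| * c₀ ≤ 3 / 16 * e₀) (hgap : μ + e₀ + 2 * |C 0| * c₀ < -2 - Real.sqrt 2) (m : ℕ) (ω : ℤ)
    (j : ℤ) {q : Fin 2 → ℝ} (hq : (π / 4) ^ 2 < q 0 ^ 2 + q 1 ^ 2) :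
    bgmSliceFn μ e₀ E h m ω (fermiMatsubara β j) q = 0 := by
  by_contra hne
  obtain ⟨hB, hf, -⟩ := bgmSliceFn_ne_zero hne
  have hqi : ∀ i, |q i| < 7 * π / 4 := fun i =>
    (abs_apply_lt_of_sq_add_sq_lt (by positivity) hB i).trans (by linarith [Real.pi_pos])
  exact absurd (sq_add_sq_lt_of_bgmShell_ne_zero hI hS he hh₁ hh₀ hU hUh hμ₁ hK₀ hgap hqi hf) (not_lt.2 hq.le)

/-- **The slice is smooth on the whole plane**: on the open disc `B` it is `γ^{-h}Φ̃` (smooth), on the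
open exterior `|q⃗| > π/4` it vanishes, and the two open sets cover the plane. [cite: BenfattoGiulianiMastropietro2006, §2.5 proof of Lemma 2.2 p0010:L146–L154] -/
theorem contDiff_bgmSliceFn (hI : BGMInitial E) (hS : BGMSmoothness β U C hβ E) (he : 0 < e₀)
    (he4 : e₀ < μ + 4) (hh₁ : hβ ≤ h) (hh₀ : h ≤ 0) (hU : |U| ≤ c₀) (hUh : |U| * |(hβ : ℝ)| ≤ c₀)
    (hμ₁ : -4 < μ) (hK₀ : |C 0| * c₀ ≤ 3 / 16 * e₀) (hgap : μ + e₀ + 2 * |C 0| * c₀ < -2 - Real.sqrt 2)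
    (hgap' : 2 * |C 0| * c₀ ≤ (μ + 4 - e₀) / 2) (m : ℕ) (ω : ℤ) (j : ℤ) {n : ℕ} :
    ContDiff ℝ n (bgmSliceFn μ e₀ E h m ω (fermiMatsubara β j)) := by
  have hπ := Real.pi_pos
  have hc : 0 < Real.sqrt ((μ + 4 - e₀) / 2) := Real.sqrt_pos.2 (by linarith)
  have hΦ : ContDiff ℝ n fun q : Fin 2 → ℝ => (((4 : ℝ) ^ (-h) : ℝ) : ℂ) *
      bgmSurrogateIntegrand μ e₀ (Real.sqrt ((μ + 4 - e₀) / 2) / 2) E h m ω (fermiMatsubara β j, q) :=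
    contDiff_const.mul (contDiff_bgmSurrogateIntegrand_slice hS he (by positivity) μ _ h m ω)
  rw [contDiff_iff_contDiffAt]
  intro q
  by_cases hq : q 0 ^ 2 + q 1 ^ 2 < (3 * π / 4) ^ 2
  · have hopen : IsOpen {q : Fin 2 → ℝ | q 0 ^ 2 + q 1 ^ 2 < (3 * π / 4) ^ 2} :=
      isOpen_lt (by fun_prop) continuous_const
    have hev : bgmSliceFn μ e₀ E h m ω (fermiMatsubara β j) =ᶠ[𝓝 q] fun q : Fin 2 → ℝ =>
        (((4 : ℝ) ^ (-h) : ℝ) : ℂ) *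
          bgmSurrogateIntegrand μ e₀ (Real.sqrt ((μ + 4 - e₀) / 2) / 2) E h m ω (fermiMatsubara β j, q) := by
      filter_upwards [hopen.mem_nhds hq] with q' hq'
      rw [bgmSliceFn_eq_indicator_surrogate hI hS he he4 hh₁ hh₀ hU hUh hK₀ hgap',
        Set.indicator_of_mem (show q' ∈ {q : Fin 2 → ℝ | q 0 ^ 2 + q 1 ^ 2 < (3 * π / 4) ^ 2} from hq')]
    exact hΦ.contDiffAt.congr_of_eventuallyEq hev
  · have hq' : (π / 4) ^ 2 < q 0 ^ 2 + q 1 ^ 2 := lt_of_lt_of_le (by nlinarith) (not_lt.1 hq)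
    have hopen : IsOpen {q : Fin 2 → ℝ | (π / 4) ^ 2 < q 0 ^ 2 + q 1 ^ 2} :=
      isOpen_lt continuous_const (by fun_prop)
    have hev : bgmSliceFn μ e₀ E h m ω (fermiMatsubara β j) =ᶠ[𝓝 q] fun _ => 0 := by
      filter_upwards [hopen.mem_nhds hq'] with q' hq''
      exact bgmSliceFn_eq_zero_of_lt hI hS he hh₁ hh₀ hU hUh hμ₁ hK₀ hgap m ω j hq''
    exact contDiffAt_const.congr_of_eventuallyEq hev

/-- The transported slice is smooth. [cite: BenfattoGiulianiMastropietro2006, §2.5 proof of Lemma 2.2 p0010:L146–L154] -/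
theorem contDiff_bgmSliceE2 (hI : BGMInitial E) (hS : BGMSmoothness β U C hβ E) (he : 0 < e₀)
    (he4 : e₀ < μ + 4) (hh₁ : hβ ≤ h) (hh₀ : h ≤ 0) (hU : |U| ≤ c₀) (hUh : |U| * |(hβ : ℝ)| ≤ c₀)
    (hμ₁ : -4 < μ) (hK₀ : |C 0| * c₀ ≤ 3 / 16 * e₀) (hgap : μ + e₀ + 2 * |C 0| * c₀ < -2 - Real.sqrt 2)
    (hgap' : 2 * |C 0| * c₀ ≤ (μ + 4 - e₀) / 2) (m : ℕ) (ω : ℤ) (j : ℤ) {n : ℕ∞} :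
    ContDiff ℝ n (bgmSliceE2 μ e₀ E h m ω (fermiMatsubara β j)) := by
  rw [contDiff_iff_forall_nat_le]
  intro n' _
  exact (contDiff_bgmSliceFn hI hS he he4 hh₁ hh₀ hU hUh hμ₁ hK₀ hgap hgap' m ω j).comp
    (PiLp.continuousLinearEquiv 2 ℝ (fun _ : Fin 2 => ℝ)).contDiff

/-- The support of the transported slice lies in the closed disc of radius `π/4`. [cite: BenfattoGiulianiMastropietro2006, §2.5 (2.46)–(2.49) p0010:L55–L75] -/
theorem tsupport_bgmSliceE2_subset_closedBall (hI : BGMInitial E) (hS : BGMSmoothness β U C hβ E) (he : 0 < e₀)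
    (hh₁ : hβ ≤ h) (hh₀ : h ≤ 0) (hU : |U| ≤ c₀) (hUh : |U| * |(hβ : ℝ)| ≤ c₀) (hμ₁ : -4 < μ)
    (hK₀ : |C 0| * c₀ ≤ 3 / 16 * e₀) (hgap : μ + e₀ + 2 * |C 0| * c₀ < -2 - Real.sqrt 2) (m : ℕ) (ω : ℤ)
    (j : ℤ) :
    tsupport (bgmSliceE2 μ e₀ E h m ω (fermiMatsubara β j)) ⊆
      Metric.closedBall (0 : EuclideanSpace ℝ (Fin 2)) (π / 4) := by
  refine closure_minimal (fun p hp => ?_) Metric.isClosed_closedBall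
  have hne : bgmSliceFn μ e₀ E h m ω (fermiMatsubara β j) (WithLp.ofLp p) ≠ 0 := hp
  have hle : ¬ (π / 4) ^ 2 < (WithLp.ofLp p) 0 ^ 2 + (WithLp.ofLp p) 1 ^ 2 := fun hlt =>
    hne (bgmSliceFn_eq_zero_of_lt hI hS he hh₁ hh₀ hU hUh hμ₁ hK₀ hgap m ω j hlt)
  rw [Metric.mem_closedBall, dist_zero_right]
  have hn : ‖p‖ ^ 2 = (WithLp.ofLp p) 0 ^ 2 + (WithLp.ofLp p) 1 ^ 2 := by
    rw [EuclideanSpace.real_norm_sq_eq, Fin.sum_univ_two]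
  have h2 : ‖p‖ ^ 2 ≤ (π / 4) ^ 2 := by rw [hn]; exact not_lt.1 hle
  exact (pow_le_pow_iff_left₀ (norm_nonneg _) (by positivity) two_ne_zero).1 h2

/-- The transported slice has compact support. [cite: BenfattoGiulianiMastropietro2006, §2.5 (2.46)–(2.49) p0010:L55–L75] -/
theorem hasCompactSupport_bgmSliceE2 (hI : BGMInitial E) (hS : BGMSmoothness β U C hβ E) (he : 0 < e₀)
    (hh₁ : hβ ≤ h) (hh₀ : h ≤ 0) (hU : |U| ≤ c₀) (hUh : |U| * |(hβ : ℝ)| ≤ c₀) (hμ₁ : -4 < μ)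
    (hK₀ : |C 0| * c₀ ≤ 3 / 16 * e₀) (hgap : μ + e₀ + 2 * |C 0| * c₀ < -2 - Real.sqrt 2) (m : ℕ) (ω : ℤ)
    (j : ℤ) : HasCompactSupport (bgmSliceE2 μ e₀ E h m ω (fermiMatsubara β j)) :=
  (isCompact_closedBall (0 : EuclideanSpace ℝ (Fin 2)) (π / 4)).of_isClosed_subset isClosed_closure
    (tsupport_bgmSliceE2_subset_closedBall hI hS he hh₁ hh₀ hU hUh hμ₁ hK₀ hgap m ω j)

/-! #### The closed window containing the support -/

/-- The cosine form of the angular window: `ζ_{m,ω}(θ) ≠ 0 ⟹ cos(θ - θ_{m,ω}) ≥ cos(3w_m/4)`. [cite: BenfattoGiulianiMastropietro2006, §2.5 (2.45) p0010:L33] -/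
theorem cos_le_cos_sub_of_sectorWeightCirc_ne_zero {m : ℕ} {ω : ℤ} {θ : ℝ}
    (hζ : sectorWeightCirc m ω θ ≠ 0) :
    Real.cos (3 * sectorWidth m / 4) ≤ Real.cos (θ - ((ω : ℝ) + 1 / 2) * sectorWidth m) := by
  by_contra hlt
  refine hζ (sectorWeightCirc_eq_zero fun k => ?_)
  by_contra hk
  push Not at hk hlt
  have hw := sectorWidth_pos m
  have hwπ := sectorWidth_le_pi m
  have h1 : Real.cos (θ - ((ω : ℝ) + 1 / 2) * sectorWidth m) =
      Real.cos (|θ - ((ω : ℝ) + 1 / 2) * sectorWidth m - 2 * π * k|) := by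
    rw [Real.cos_abs, show θ - ((ω : ℝ) + 1 / 2) * sectorWidth m - 2 * π * k =
      θ - ((ω : ℝ) + 1 / 2) * sectorWidth m - k * (2 * π) by ring, Real.cos_sub_int_mul_two_pi]
  rw [h1] at hlt
  exact absurd (Real.cos_le_cos_of_nonneg_of_le_pi (abs_nonneg _) (by linarith) hk.le) (not_le.2 hlt)

/-- The converse on a ray: `cos(θ - θ₀) ≥ cos(w_a)`, `0 ≤ w_a ≤ π` ⟹ `|θ - θ₀ - 2πk| ≤ w_a` for some `k ∈ ℤ`. [folklore] -/
private theorem exists_abs_sub_le_of_cos_le {t wa : ℝ} (hwa0 : 0 ≤ wa) (hwa : wa ≤ π)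
    (hcos : Real.cos wa ≤ Real.cos t) : ∃ k : ℤ, |t - 2 * π * k| ≤ wa := by
  have hπ := Real.pi_pos
  refine ⟨round (t / (2 * π)), ?_⟩
  have h1 : |t / (2 * π) - round (t / (2 * π))| ≤ 1 / 2 := abs_sub_round _
  have h2 : |t - 2 * π * round (t / (2 * π))| ≤ π := by
    have : t - 2 * π * round (t / (2 * π)) = 2 * π * (t / (2 * π) - round (t / (2 * π))) := by
      field_simp
    rw [this, abs_mul, abs_of_pos (by positivity : (0 : ℝ) < 2 * π)]
    nlinarith
  by_contra hlt
  push Not at hlt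
  have h3 : Real.cos t = Real.cos (|t - 2 * π * round (t / (2 * π))|) := by
    rw [Real.cos_abs, show t - 2 * π * (round (t / (2 * π)) : ℝ) =
      t - (round (t / (2 * π)) : ℤ) * (2 * π) by ring, Real.cos_sub_int_mul_two_pi]
  rw [h3] at hcos
  exact absurd (Real.cos_lt_cos_of_nonneg_of_le_pi hwa0 h2 hlt) (not_lt.2 hcos)

/-- The radial coordinates of a plane vector through its polar angle: `q₀ = |q⃗| cos θ(q⃗)`,
`q₁ = |q⃗| sin θ(q⃗)`. [folklore] -/
private theorem apply_eq_norm_mul_polarAngle (q : Fin 2 → ℝ) :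
    q 0 = ‖momToComplex q‖ * Real.cos (polarAngle q) ∧ q 1 = ‖momToComplex q‖ * Real.sin (polarAngle q) := by
  refine ⟨?_, ?_⟩
  · rw [polarAngle, Complex.norm_mul_cos_arg, momToComplex_re]
  · rw [polarAngle, Complex.norm_mul_sin_arg, momToComplex_im]

/-- **The support window of the slice** (closed conditions): `|q⃗| ≤ π/4`, `|q⃗| ≥ c`,
`|Re E_h(k₀,q⃗) - μ| ≤ e₀γ^h` and the angular window `|q⃗| cos(3w_m/4) ≤ q⃗·e⃗_r(θ_{m,ω})`. [cite: BenfattoGiulianiMastropietro2006, §2.5 (2.46) p0010:L55–L62] -/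
theorem bgmSliceFn_window (hI : BGMInitial E) (hS : BGMSmoothness β U C hβ E) (he : 0 < e₀)
    (hh₁ : hβ ≤ h) (hh₀ : h ≤ 0) (hU : |U| ≤ c₀) (hUh : |U| * |(hβ : ℝ)| ≤ c₀) (hμ₁ : -4 < μ)
    (hK₀ : |C 0| * c₀ ≤ 3 / 16 * e₀) (hgap : μ + e₀ + 2 * |C 0| * c₀ < -2 - Real.sqrt 2)
    (hgap' : 2 * |C 0| * c₀ ≤ (μ + 4 - e₀) / 2) (m : ℕ) (ω : ℤ) (j : ℤ) {q : Fin 2 → ℝ}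
    (hq : bgmSliceFn μ e₀ E h m ω (fermiMatsubara β j) q ≠ 0) :
    q 0 ^ 2 + q 1 ^ 2 ≤ (π / 4) ^ 2 ∧ (μ + 4 - e₀) / 2 ≤ q 0 ^ 2 + q 1 ^ 2 ∧
      |(E h (fermiMatsubara β j, q)).re - μ| ≤ e₀ * (4 : ℝ) ^ h ∧
      Real.sqrt (q 0 ^ 2 + q 1 ^ 2) * Real.cos (3 * sectorWidth m / 4) ≤
        q 0 * Real.cos (((ω : ℝ) + 1 / 2) * sectorWidth m) + q 1 * Real.sin (((ω : ℝ) + 1 / 2) * sectorWidth m) := by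
  obtain ⟨hB, hf, hζ⟩ := bgmSliceFn_ne_zero hq
  have hk₀ : fermiMatsubara β j ∈ matsubaraSet β := ⟨j, rfl⟩
  have hqi : ∀ i, |q i| < 7 * π / 4 := fun i =>
    (abs_apply_lt_of_sq_add_sq_lt (by positivity) hB i).trans (by linarith [Real.pi_pos])
  refine ⟨(sq_add_sq_lt_of_bgmShell_ne_zero hI hS he hh₁ hh₀ hU hUh hμ₁ hK₀ hgap hqi hf).le, ?_, ?_, ?_⟩
  · have := lt_sq_add_sq_of_bgmShell_ne_zero (μ := μ) hI hS he hh₁ hh₀ hU hUh hK₀ hf; linarith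
  · exact (abs_re_sub_lt_of_bgmShell_ne_zero he (norm_E_sub_E_le_threshold hS hh₁ hh₀ hUh hK₀ hk₀ q) hf).le
  · have hcos := cos_le_cos_sub_of_sectorWeightCirc_ne_zero hζ
    obtain ⟨h0, h1⟩ := apply_eq_norm_mul_polarAngle q
    have hn : Real.sqrt (q 0 ^ 2 + q 1 ^ 2) = ‖momToComplex q‖ := by
      rw [← norm_momToComplex_sq, Real.sqrt_sq (norm_nonneg _)]
    rw [hn, h0, h1]
    have : ‖momToComplex q‖ * Real.cos (polarAngle q) * Real.cos (((ω : ℝ) + 1 / 2) * sectorWidth m) +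
        ‖momToComplex q‖ * Real.sin (polarAngle q) * Real.sin (((ω : ℝ) + 1 / 2) * sectorWidth m) =
        ‖momToComplex q‖ * Real.cos (polarAngle q - ((ω : ℝ) + 1 / 2) * sectorWidth m) := by
      rw [Real.cos_sub]; ring
    rw [this]
    exact mul_le_mul_of_nonneg_left hcos (norm_nonneg _)

/-- The window is a closed set. [folklore] -/
private theorem isClosed_window (hS : BGMSmoothness β U C hβ E) (μ e₀ : ℝ) (h : ℤ) (m : ℕ) (ω : ℤ) (k₀ : ℝ) :
    IsClosed {q : Fin 2 → ℝ | q 0 ^ 2 + q 1 ^ 2 ≤ (π / 4) ^ 2 ∧ (μ + 4 - e₀) / 2 ≤ q 0 ^ 2 + q 1 ^ 2 ∧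
      |(E h (k₀, q)).re - μ| ≤ e₀ * (4 : ℝ) ^ h ∧
      Real.sqrt (q 0 ^ 2 + q 1 ^ 2) * Real.cos (3 * sectorWidth m / 4) ≤
        q 0 * Real.cos (((ω : ℝ) + 1 / 2) * sectorWidth m) + q 1 * Real.sin (((ω : ℝ) + 1 / 2) * sectorWidth m)} := by
  have hE : Continuous fun q : Fin 2 → ℝ => (E h (k₀, q)).re :=
    Complex.continuous_re.comp (hS.1 h k₀ 0).continuous
  have hsq : Continuous fun q : Fin 2 → ℝ => q 0 ^ 2 + q 1 ^ 2 := by fun_prop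
  have hlin : Continuous fun q : Fin 2 → ℝ =>
      q 0 * Real.cos (((ω : ℝ) + 1 / 2) * sectorWidth m) + q 1 * Real.sin (((ω : ℝ) + 1 / 2) * sectorWidth m) := by
    fun_prop
  exact (isClosed_le hsq continuous_const).inter ((isClosed_le continuous_const hsq).inter
    ((isClosed_le ((hE.sub continuous_const).abs) continuous_const).inter
      (isClosed_le (hsq.sqrt.mul continuous_const) hlin)))

/-- The topological support of the transported slice lies in the window. [cite: BenfattoGiulianiMastropietro2006, §2.5 (2.46) p0010:L55–L62] -/
theorem tsupport_bgmSliceE2_subset_window (hI : BGMInitial E) (hS : BGMSmoothness β U C hβ E) (he : 0 < e₀)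
    (hh₁ : hβ ≤ h) (hh₀ : h ≤ 0) (hU : |U| ≤ c₀) (hUh : |U| * |(hβ : ℝ)| ≤ c₀) (hμ₁ : -4 < μ)
    (hK₀ : |C 0| * c₀ ≤ 3 / 16 * e₀) (hgap : μ + e₀ + 2 * |C 0| * c₀ < -2 - Real.sqrt 2)
    (hgap' : 2 * |C 0| * c₀ ≤ (μ + 4 - e₀) / 2) (m : ℕ) (ω : ℤ) (j : ℤ) :
    tsupport (bgmSliceE2 μ e₀ E h m ω (fermiMatsubara β j)) ⊆
      {p | (WithLp.ofLp p) 0 ^ 2 + (WithLp.ofLp p) 1 ^ 2 ≤ (π / 4) ^ 2 ∧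
        (μ + 4 - e₀) / 2 ≤ (WithLp.ofLp p) 0 ^ 2 + (WithLp.ofLp p) 1 ^ 2 ∧
        |(E h (fermiMatsubara β j, WithLp.ofLp p)).re - μ| ≤ e₀ * (4 : ℝ) ^ h ∧
        Real.sqrt ((WithLp.ofLp p) 0 ^ 2 + (WithLp.ofLp p) 1 ^ 2) * Real.cos (3 * sectorWidth m / 4) ≤
          (WithLp.ofLp p) 0 * Real.cos (((ω : ℝ) + 1 / 2) * sectorWidth m) +
            (WithLp.ofLp p) 1 * Real.sin (((ω : ℝ) + 1 / 2) * sectorWidth m)} :=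
  closure_minimal (fun _ hp => bgmSliceFn_window hI hS he hh₁ hh₀ hU hUh hμ₁ hK₀ hgap hgap' m ω j hp)
    ((isClosed_window hS μ e₀ h m ω (fermiMatsubara β j)).preimage
      (PiLp.continuousLinearEquiv 2 ℝ (fun _ : Fin 2 => ℝ)).continuous)

/-- The topological support of the transported slice lies over the closure of the support of `f_h(k₀, ·)`. [cite: BenfattoGiulianiMastropietro2006, §2.5 (2.46) p0010:L55–L62] -/
theorem tsupport_bgmSliceE2_subset_closure (μ e₀ : ℝ) (E : ℤ → ℝ × (Fin 2 → ℝ) → ℂ) (h : ℤ) (m : ℕ) (ω : ℤ)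
    (k₀ : ℝ) :
    tsupport (bgmSliceE2 μ e₀ E h m ω k₀) ⊆
      {p | WithLp.ofLp p ∈ closure {q : Fin 2 → ℝ | bgmShell e₀ μ E h (k₀, q) ≠ 0}} := by
  have h1 : Function.support (bgmSliceE2 μ e₀ E h m ω k₀) ⊆
      WithLp.ofLp ⁻¹' {q : Fin 2 → ℝ | bgmShell e₀ μ E h (k₀, q) ≠ 0} := fun p hp =>
    (bgmSliceFn_ne_zero hp).2.1
  exact (closure_mono h1).trans
    ((PiLp.continuousLinearEquiv 2 ℝ (fun _ : Fin 2 => ℝ)).continuous.closure_preimage_subset _)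

/-! #### Directional derivatives of the slice: the sup bound and the `L¹` bound -/

/-- Rescaling a one-variable function: `(G(c·))^{(i)}(σ) = cⁱ G^{(i)}(cσ)`. [folklore] -/
private theorem iteratedDeriv_comp_mul_left (G : ℝ → ℂ) {n : ℕ} (hG : ContDiff ℝ n G) (c : ℝ) (σ : ℝ) :
    iteratedDeriv n (fun σ : ℝ => G (c * σ)) σ = c ^ n • iteratedDeriv n G (c * σ) :=
  congrFun (iteratedDeriv_comp_const_smul hG c) σ

/-- **The directional derivatives of the slice are `O(γ^{-h}γ^{-Nh})`, uniformly** (N pure derivatives in a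
direction `v` with `|v_i| ≤ 1` cost `γ^{-h}` each, on top of the size `γ^{-h}` of the integrand): the line
through `x` in direction `v` is the rescaled line of `BGM2006Sec2ShellLineBounds` read at `σ = γ^{-h}s`.
[cite: BenfattoGiulianiMastropietro2006, §2.5 proof of Lemma 2.2 p0010:L146–L154, Lemma 2.3 p0011:L133–L140] -/
theorem exists_norm_iteratedFDeriv_bgmSliceE2_le {μ e₀ : ℝ} (hμ₁ : -4 < μ) (he : 0 < e₀) (he4 : e₀ < μ + 4)
    (C : ℕ → ℝ) (N : ℕ) {c₀ : ℝ} (hc₁ : c₀ ≤ 1) :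
    ∃ K : ℝ, 0 ≤ K ∧ ∀ (β U : ℝ) (hβ : ℤ) (E : ℤ → ℝ × (Fin 2 → ℝ) → ℂ),
      BGMInitial E → BGMSmoothness β U C hβ E → |U| ≤ c₀ → |U| * |(hβ : ℝ)| ≤ c₀ →
      |C 0| * c₀ ≤ 3 / 16 * e₀ → μ + e₀ + 2 * |C 0| * c₀ < -2 - Real.sqrt 2 →
      2 * |C 0| * c₀ ≤ (μ + 4 - e₀) / 2 →
      ∀ h : ℤ, hβ ≤ h → h ≤ 0 → ∀ (m : ℕ) (ω : ℤ), (4 : ℝ) ^ h ≤ sectorWidth m →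
      ∀ (j : ℤ) (x v : EuclideanSpace ℝ (Fin 2)), ‖WithLp.ofLp v‖ ≤ 1 →
      ‖iteratedFDeriv ℝ N (bgmSliceE2 μ e₀ E h m ω (fermiMatsubara β j)) x (fun _ => v)‖ ≤
        K * ((4 : ℝ) ^ (-h) * (4 : ℝ) ^ (-((N : ℤ) * h))) := by
  obtain ⟨K, hK0, hK⟩ := exists_norm_iteratedDeriv_bgmSurrogateIntegrand_line_le (μ := μ) he he4 C N hc₁
  refine ⟨K, hK0, fun β U hβ E hI hS hU hUh hK₀ hgap hgap' h hh₁ hh₀ m ω hwm j x v hv => ?_⟩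
  have hπ := Real.pi_pos
  have h4 : (0 : ℝ) < (4 : ℝ) ^ h := zpow_pos (by norm_num) _
  have h4' : (0 : ℝ) < (4 : ℝ) ^ (-h) := zpow_pos (by norm_num) _
  have hscale : 0 ≤ K * ((4 : ℝ) ^ (-h) * (4 : ℝ) ^ (-((N : ℤ) * h))) := by positivity
  -- the smooth slice
  have hf : ContDiff ℝ N (bgmSliceE2 μ e₀ E h m ω (fermiMatsubara β j)) :=
    contDiff_bgmSliceE2 hI hS he he4 hh₁ hh₀ hU hUh hμ₁ hK₀ hgap hgap' m ω j
  by_cases hx : x ∈ tsupport (bgmSliceE2 μ e₀ E h m ω (fermiMatsubara β j))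
  · -- on the support: the line restriction and the rescaling
    obtain ⟨q, hq⟩ : ∃ q : Fin 2 → ℝ, q = WithLp.ofLp x := ⟨_, rfl⟩
    obtain ⟨w, hw⟩ : ∃ w : Fin 2 → ℝ, w = WithLp.ofLp v := ⟨_, rfl⟩
    have hwin := tsupport_bgmSliceE2_subset_window hI hS he hh₁ hh₀ hU hUh hμ₁ hK₀ hgap hgap' m ω j hx
    have hcl := tsupport_bgmSliceE2_subset_closure μ e₀ E h m ω (fermiMatsubara β j) hx
    simp only [Set.mem_setOf_eq, ← hq] at hwin hcl
    have hqB : q ∈ {q : Fin 2 → ℝ | q 0 ^ 2 + q 1 ^ 2 < (3 * π / 4) ^ 2} := by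
      simp only [Set.mem_setOf_eq]; nlinarith [hwin.1]
    have hopen : IsOpen {q : Fin 2 → ℝ | q 0 ^ 2 + q 1 ^ 2 < (3 * π / 4) ^ 2} :=
      isOpen_lt (by fun_prop) continuous_const
    -- the line restriction
    have hline := iteratedDeriv_lineRestriction hf x v 0
    rw [zero_smul, add_zero] at hline
    rw [← hline]
    -- near `s = 0` the line restriction is `γ^{-h} Φ̃(q + s w)`
    have hB0 : {q : Fin 2 → ℝ | q 0 ^ 2 + q 1 ^ 2 < (3 * π / 4) ^ 2} ∈ 𝓝 (q + (0 : ℝ) • w) := by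
      rw [zero_smul, add_zero]; exact hopen.mem_nhds hqB
    have hev0 : ∀ᶠ s : ℝ in 𝓝 0, q + s • w ∈ {q : Fin 2 → ℝ | q 0 ^ 2 + q 1 ^ 2 < (3 * π / 4) ^ 2} :=
      (by fun_prop : Continuous fun s : ℝ => q + s • w).continuousAt.preimage_mem_nhds hB0
    have hev : (fun s : ℝ => bgmSliceE2 μ e₀ E h m ω (fermiMatsubara β j) (x + s • v)) =ᶠ[𝓝 0]
        fun s : ℝ => (((4 : ℝ) ^ (-h) : ℝ) : ℂ) *
          bgmSurrogateIntegrand μ e₀ (Real.sqrt ((μ + 4 - e₀) / 2) / 2) E h m ω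
            (fermiMatsubara β j, q + ((4 : ℝ) ^ (-h) * s) • ((4 : ℝ) ^ h • w)) := by
      filter_upwards [hev0] with s hs
      have hxs : WithLp.ofLp (x + s • v) = q + s • w := by rw [WithLp.ofLp_add, WithLp.ofLp_smul, hq, hw]
      have hsw : ((4 : ℝ) ^ (-h) * s) • ((4 : ℝ) ^ h • w) = s • w := by
        rw [smul_smul, show (4 : ℝ) ^ (-h) * s * (4 : ℝ) ^ h = s by rw [zpow_neg]; field_simp]
      rw [bgmSliceE2, hxs, bgmSliceFn_eq_indicator_surrogate hI hS he he4 hh₁ hh₀ hU hUh hK₀ hgap',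
        Set.indicator_of_mem (show q + s • w ∈ {q : Fin 2 → ℝ | q 0 ^ 2 + q 1 ^ 2 < (3 * π / 4) ^ 2} from hs),
        hsw]
    rw [hev.iteratedDeriv_eq]
    -- the rescaled line function and its derivative bound
    have hG : ContDiff ℝ N fun σ : ℝ => bgmSurrogateIntegrand μ e₀ (Real.sqrt ((μ + 4 - e₀) / 2) / 2) E h m ω
        (fermiMatsubara β j, q + σ • ((4 : ℝ) ^ h • w)) :=
      contDiff_lineRestriction (contDiff_bgmSurrogateIntegrand_slice hS he (by positivity) μ _ h m ω) q _
    have hwn : ‖w‖ ≤ 1 := by rw [hw]; exact hv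
    have hKN := hK β U hβ E hI hS hU hUh hK₀ hgap' h hh₁ hh₀ m ω hwm j q w hwn hcl N le_rfl
    have hGc : ContDiff ℝ N fun s : ℝ => bgmSurrogateIntegrand μ e₀ (Real.sqrt ((μ + 4 - e₀) / 2) / 2) E h m ω
        (fermiMatsubara β j, q + ((4 : ℝ) ^ (-h) * s) • ((4 : ℝ) ^ h • w)) :=
      hG.comp (contDiff_const.mul contDiff_id)
    rw [iteratedDeriv_const_mul _ hGc.contDiffAt,
      iteratedDeriv_comp_mul_left (fun σ : ℝ => bgmSurrogateIntegrand μ e₀ (Real.sqrt ((μ + 4 - e₀) / 2) / 2)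
        E h m ω (fermiMatsubara β j, q + σ • ((4 : ℝ) ^ h • w))) hG ((4 : ℝ) ^ (-h)) 0,
      mul_zero, norm_mul, norm_smul, Complex.norm_real, Real.norm_eq_abs, abs_of_pos h4', norm_pow,
      Real.norm_eq_abs, abs_of_pos h4']
    have hpow : ((4 : ℝ) ^ (-h)) ^ N = (4 : ℝ) ^ (-((N : ℤ) * h)) := by
      rw [← zpow_natCast, ← zpow_mul]; congr 1; ring
    rw [hpow]
    calc (4 : ℝ) ^ (-h) * ((4 : ℝ) ^ (-((N : ℤ) * h)) * ‖iteratedDeriv N (fun σ : ℝ =>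
          bgmSurrogateIntegrand μ e₀ (Real.sqrt ((μ + 4 - e₀) / 2) / 2) E h m ω
            (fermiMatsubara β j, q + σ • ((4 : ℝ) ^ h • w))) 0‖)
        ≤ (4 : ℝ) ^ (-h) * ((4 : ℝ) ^ (-((N : ℤ) * h)) * K) := by gcongr
      _ = K * ((4 : ℝ) ^ (-h) * (4 : ℝ) ^ (-((N : ℤ) * h))) := by ring
  · -- off the support all derivatives vanish
    have h0 : iteratedFDeriv ℝ N (bgmSliceE2 μ e₀ E h m ω (fermiMatsubara β j)) x = 0 := by
      by_contra hne
      exact hx (support_iteratedFDeriv_subset N (Function.mem_support.2 hne))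
    rw [h0]
    simpa using hscale


/-- Polar coordinates of a ray point. [folklore] -/
private theorem smul_dir_apply (ρ θ : ℝ) :
    (ρ • dir θ) 0 = ρ * Real.cos θ ∧ (ρ • dir θ) 1 = ρ * Real.sin θ := by
  simp [dir]

/-- `|ρ e⃗_r(θ)|² = ρ²`. [folklore] -/
private theorem sq_add_sq_smul_dir (ρ θ : ℝ) : (ρ • dir θ) 0 ^ 2 + (ρ • dir θ) 1 ^ 2 = ρ ^ 2 := by
  obtain ⟨h0, h1⟩ := smul_dir_apply ρ θ
  rw [h0, h1]
  nlinarith [Real.cos_sq_add_sin_sq θ]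

/-- **The `L¹` norm of a directional derivative of the slice from a pointwise bound**: if
`‖∂ᵥ^N(1_B F/D)‖ ≤ M` everywhere then `∫‖∂ᵥ^N(1_B F/D)‖ ≤ 6(3w_m/4)·(π/4)M·2e₀γ^h/(2c/π)` — the sup times the
measure of the support window (the polar support lemma of `BGM2006Sec2ShellSupport` with the window of
`tsupport`; the direction `v` and the bound `M` are free, so both the isotropic and the anisotropic budgets
feed it). [cite: BenfattoGiulianiMastropietro2006, §2.5 proof of Lemma 2.2 p0010:L146–p0011:L7, Lemma 2.3 p0011:L133–L140] -/
theorem integral_norm_iteratedFDeriv_bgmSliceE2_le_of_bound (hI : BGMInitial E) (hS : BGMSmoothness β U C hβ E)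
    (he : 0 < e₀) (he4 : e₀ < μ + 4) (hh₁ : hβ ≤ h) (hh₀ : h ≤ 0) (hU : |U| ≤ c₀) (hUh : |U| * |(hβ : ℝ)| ≤ c₀)
    (hμ₁ : -4 < μ) (hK₀ : |C 0| * c₀ ≤ 3 / 16 * e₀) (hgap : μ + e₀ + 2 * |C 0| * c₀ < -2 - Real.sqrt 2)
    (hgap' : 2 * |C 0| * c₀ ≤ (μ + 4 - e₀) / 2)
    (hδ₁ : 2 * (2 * |C 1| * c₀ ^ 2) ≤ 2 / π * Real.sqrt ((μ + 4 - e₀) / 2)) (m : ℕ) {ω : ℕ}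
    (hω : ω < sectorCount m) (j : ℤ) (N : ℕ) (v : EuclideanSpace ℝ (Fin 2)) {M : ℝ} (hM0 : 0 ≤ M)
    (hM : ∀ x, ‖iteratedFDeriv ℝ N (bgmSliceE2 μ e₀ E h m ω (fermiMatsubara β j)) x (fun _ => v)‖ ≤ M) :
    ∫ x, ‖iteratedFDeriv ℝ N (bgmSliceE2 μ e₀ E h m ω (fermiMatsubara β j)) x (fun _ => v)‖ ≤
      6 * (3 * sectorWidth m / 4) * (π / 4 * M *
        (2 * (e₀ * (4 : ℝ) ^ h / (2 / π * Real.sqrt ((μ + 4 - e₀) / 2))))) := by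
  have hπ := Real.pi_pos
  obtain ⟨c, hc⟩ : ∃ c : ℝ, c = Real.sqrt ((μ + 4 - e₀) / 2) := ⟨_, rfl⟩
  have hcpos : 0 < c := by rw [hc]; exact Real.sqrt_pos.2 (by linarith)
  have hcsq : c ^ 2 = (μ + 4 - e₀) / 2 := by rw [hc]; exact Real.sq_sqrt (by linarith)
  have h4 : (0 : ℝ) < (4 : ℝ) ^ h := zpow_pos (by norm_num) _
  have hw := sectorWidth_pos m
  obtain ⟨f, hf⟩ : ∃ f : EuclideanSpace ℝ (Fin 2) → ℂ, f = bgmSliceE2 μ e₀ E h m ω (fermiMatsubara β j) :=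
    ⟨_, rfl⟩
  have hfN : ContDiff ℝ N f := by
    rw [hf]; exact contDiff_bgmSliceE2 hI hS he he4 hh₁ hh₀ hU hUh hμ₁ hK₀ hgap hgap' m ω j
  rw [← hf] at hM ⊢
  -- transfer to `Fin 2 → ℝ`
  obtain ⟨g, hg⟩ : ∃ g : (Fin 2 → ℝ) → ℝ, g = fun q => ‖iteratedFDeriv ℝ N f (WithLp.toLp 2 q) (fun _ => v)‖ :=
    ⟨_, rfl⟩
  have htransfer : ∫ x, ‖iteratedFDeriv ℝ N f x (fun _ => v)‖ = ∫ q, g q := by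
    rw [hg]
    exact ((PiLp.volume_preserving_toLp (Fin 2)).integral_comp
      (MeasurableEquiv.toLp 2 (Fin 2 → ℝ)).measurableEmbedding
      (fun x : EuclideanSpace ℝ (Fin 2) => ‖iteratedFDeriv ℝ N f x (fun _ => v)‖)).symm
  rw [htransfer]
  -- the window of the support, read at `toLp q`
  have hwin : ∀ q : Fin 2 → ℝ, g q ≠ 0 →
      q 0 ^ 2 + q 1 ^ 2 ≤ (π / 4) ^ 2 ∧ (μ + 4 - e₀) / 2 ≤ q 0 ^ 2 + q 1 ^ 2 ∧
      |(E h (fermiMatsubara β j, q)).re - μ| ≤ e₀ * (4 : ℝ) ^ h ∧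
      Real.sqrt (q 0 ^ 2 + q 1 ^ 2) * Real.cos (3 * sectorWidth m / 4) ≤
        q 0 * Real.cos ((((ω : ℤ) : ℝ) + 1 / 2) * sectorWidth m) +
          q 1 * Real.sin ((((ω : ℤ) : ℝ) + 1 / 2) * sectorWidth m) := by
    intro q hgq
    have hne : iteratedFDeriv ℝ N f (WithLp.toLp 2 q) ≠ 0 := fun h0 => hgq (by rw [hg]; simp [h0])
    have hts : WithLp.toLp 2 q ∈ tsupport f := support_iteratedFDeriv_subset N (Function.mem_support.2 hne)
    rw [hf] at hts
    exact tsupport_bgmSliceE2_subset_window hI hS he hh₁ hh₀ hU hUh hμ₁ hK₀ hgap hgap' m ω j hts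
  -- `g` lives in the disc `B`
  have hgB : (fun q => g q) = {q : Fin 2 → ℝ | q 0 ^ 2 + q 1 ^ 2 < (3 * π / 4) ^ 2}.indicator g := by
    funext q
    by_cases hq : q ∈ {q : Fin 2 → ℝ | q 0 ^ 2 + q 1 ^ 2 < (3 * π / 4) ^ 2}
    · rw [Set.indicator_of_mem hq]
    · rw [Set.indicator_of_notMem hq]
      by_contra hgq
      have h1 := (hwin q hgq).1
      simp only [Set.mem_setOf_eq, not_lt] at hq
      nlinarith
  rw [show (∫ q, g q) = ∫ q, (fun q => g q) q from rfl, hgB]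
  -- the polar support lemma
  have hgm : Measurable g := by
    rw [hg]
    exact (((continuous_eval_const (fun _ : Fin N => v)).comp
      ((hfN.continuous_iteratedFDeriv le_rfl).comp (PiLp.continuous_toLp 2 _))).norm).measurable
  have hg0 : ∀ q, 0 ≤ g q := fun q => by rw [hg]; exact norm_nonneg _
  have hθ₀ : sectorCenter m ω ∈ Icc 0 (2 * π) := by
    have hN := sectorCount_mul_sectorWidth m
    have hω' : (ω : ℝ) + 1 ≤ sectorCount m := by exact_mod_cast hω
    refine ⟨by unfold sectorCenter; positivity, ?_⟩
    unfold sectorCenter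
    nlinarith
  have hwa : 3 * sectorWidth m / 4 ≤ π := by linarith [sectorWidth_le_pi m]
  refine integral_indicator_ball_le_of_support hgm hg0 hM0 (fun q => by rw [hg]; exact hM _) hθ₀
    (by positivity) hwa
    (by positivity : (0 : ℝ) ≤ e₀ * (4 : ℝ) ^ h / (2 / π * Real.sqrt ((μ + 4 - e₀) / 2)))
    (levelRadius (fun q => (E h (fermiMatsubara β j, q)).re) μ) fun ρ θ hρ _ hgq => ?_
  obtain ⟨hle, hge, hre, hang⟩ := hwin _ hgq
  rw [sq_add_sq_smul_dir] at hle hge hang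
  have hρπ : ρ ≤ π / 4 := (pow_le_pow_iff_left₀ hρ.1.le (by positivity) two_ne_zero).1 hle
  have hcρ : Real.sqrt ((μ + 4 - e₀) / 2) ≤ ρ := by
    rw [← hc]; exact (pow_le_pow_iff_left₀ hcpos.le hρ.1.le two_ne_zero).1 (by rw [hcsq]; exact hge)
  obtain ⟨-, -, -, hwin'⟩ := radial_window hI hS he hh₁ hh₀ hU hgap hgap' he4 hδ₁ j θ
  refine ⟨hρπ, hwin' _ ρ hcρ (by linarith) hre, ?_⟩
  -- the angular window
  obtain ⟨h0, h1⟩ := smul_dir_apply ρ θ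
  rw [Real.sqrt_sq hρ.1.le, h0, h1] at hang
  have hcos : Real.cos (3 * sectorWidth m / 4) ≤ Real.cos (θ - sectorCenter m ω) := by
    rw [Real.cos_sub, sectorCenter]
    push_cast at hang
    have : ρ * Real.cos (3 * sectorWidth m / 4) ≤
        ρ * (Real.cos θ * Real.cos (((ω : ℝ) + 1 / 2) * sectorWidth m) +
          Real.sin θ * Real.sin (((ω : ℝ) + 1 / 2) * sectorWidth m)) := by linarith
    exact le_of_mul_le_mul_left this hρ.1
  obtain ⟨k, hk⟩ := exists_abs_sub_le_of_cos_le (by positivity) hwa hcos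
  exact ⟨k, hk⟩

/-- **The `L¹` norm of the directional derivatives of the slice is `O(w_m γ^{-Nh})`, uniformly in `β`**
(directions `|vᵢ| ≤ 1`, angular index `m` with `γ^h ≤ w_m`): the sup `K γ^{-h}γ^{-Nh}` times the measure
`≲ w_m · e₀γ^h/c` of the support. [cite: BenfattoGiulianiMastropietro2006, §2.5 proof of Lemma 2.2 p0010:L146–p0011:L7, Lemma 2.3 p0011:L133–L140] -/
theorem exists_integral_norm_iteratedFDeriv_bgmSliceE2_le {μ e₀ : ℝ} (hμ₁ : -4 < μ) (he : 0 < e₀)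
    (he4 : e₀ < μ + 4) (C : ℕ → ℝ) (N : ℕ) {c₀ : ℝ} (hc₁ : c₀ ≤ 1) :
    ∃ K : ℝ, 0 ≤ K ∧ ∀ (β U : ℝ) (hβ : ℤ) (E : ℤ → ℝ × (Fin 2 → ℝ) → ℂ),
      BGMInitial E → BGMSmoothness β U C hβ E → |U| ≤ c₀ → |U| * |(hβ : ℝ)| ≤ c₀ →
      |C 0| * c₀ ≤ 3 / 16 * e₀ → μ + e₀ + 2 * |C 0| * c₀ < -2 - Real.sqrt 2 →
      2 * |C 0| * c₀ ≤ (μ + 4 - e₀) / 2 → 2 * (2 * |C 1| * c₀ ^ 2) ≤ 2 / π * Real.sqrt ((μ + 4 - e₀) / 2) →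
      ∀ h : ℤ, hβ ≤ h → h ≤ 0 → ∀ (m ω : ℕ), ω < sectorCount m → (4 : ℝ) ^ h ≤ sectorWidth m →
      ∀ (j : ℤ) (v : EuclideanSpace ℝ (Fin 2)), ‖WithLp.ofLp v‖ ≤ 1 →
      ∫ x, ‖iteratedFDeriv ℝ N (bgmSliceE2 μ e₀ E h m ω (fermiMatsubara β j)) x (fun _ => v)‖ ≤
        K * sectorWidth m * (4 : ℝ) ^ (-((N : ℤ) * h)) := by
  have hπ := Real.pi_pos
  obtain ⟨c, hc⟩ : ∃ c : ℝ, c = Real.sqrt ((μ + 4 - e₀) / 2) := ⟨_, rfl⟩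
  have hcpos : 0 < c := by rw [hc]; exact Real.sqrt_pos.2 (by linarith)
  obtain ⟨K₁, hK₁0, hK₁⟩ := exists_norm_iteratedFDeriv_bgmSliceE2_le hμ₁ he he4 C N hc₁
  refine ⟨6 * (3 / 4) * (π / 4) * K₁ * (2 * (e₀ / (2 / π * c))), by positivity,
    fun β U hβ E hI hS hU hUh hK₀ hgap hgap' hδ₁ h hh₁ hh₀ m ω hω hwm j v hv => ?_⟩
  have h4 : (0 : ℝ) < (4 : ℝ) ^ h := zpow_pos (by norm_num) _
  have hw := sectorWidth_pos m
  have hM : ∀ x, ‖iteratedFDeriv ℝ N (bgmSliceE2 μ e₀ E h m ω (fermiMatsubara β j)) x (fun _ => v)‖ ≤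
      K₁ * ((4 : ℝ) ^ (-h) * (4 : ℝ) ^ (-((N : ℤ) * h))) :=
    fun x => hK₁ β U hβ E hI hS hU hUh hK₀ hgap hgap' h hh₁ hh₀ m ω hwm j x v hv
  refine (integral_norm_iteratedFDeriv_bgmSliceE2_le_of_bound hI hS he he4 hh₁ hh₀ hU hUh hμ₁ hK₀ hgap hgap'
    hδ₁ m hω j N v (by positivity) hM).trans (le_of_eq ?_)
  have hS0 : 0 < Real.sqrt ((μ + 4 - e₀) / 2) := by rw [← hc]; exact hcpos
  rw [zpow_neg (4 : ℝ) h, hc]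
  field_simp

end Slice

/-! ### §2 The Fourier side: the slice integral of (2.49) and its decay in `x⃗` -/

section Fourier

variable {μ e₀ β U c₀ : ℝ} {C : ℕ → ℝ} {hβ : ℤ} {E : ℤ → ℝ × (Fin 2 → ℝ) → ℂ} {h : ℤ}

/-- Inner products of the Euclidean plane in coordinates. [folklore] -/
private theorem inner_E2 (a b : EuclideanSpace ℝ (Fin 2)) : inner ℝ a b = a 0 * b 0 + a 1 * b 1 := by
  simp [PiLp.inner_apply, Fin.sum_univ_two, mul_comm]

/-- **The shifted period-cell integral of (2.49) at one frequency is, up to a unimodular phase, the Fourier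
transform of the slice** at `ξ = x⃗/(2π)`: for a shift `|pᵢ| < π/4` the translated cell contains exactly one
copy of the support. [cite: BenfattoGiulianiMastropietro2006, §2.5 (2.49) p0010:L72, proof of Lemma 2.2 p0010:L146–L154] -/
theorem norm_sliceIntegral_eq_norm_fourier (hI : BGMInitial E) (hS : BGMSmoothness β U C hβ E) (he : 0 < e₀)
    (hh₁ : hβ ≤ h) (hh₀ : h ≤ 0) (hU : |U| ≤ c₀) (hUh : |U| * |(hβ : ℝ)| ≤ c₀) (hμ₁ : -4 < μ)
    (hK₀ : |C 0| * c₀ ≤ 3 / 16 * e₀) (hgap : μ + e₀ + 2 * |C 0| * c₀ < -2 - Real.sqrt 2)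
    {p : Fin 2 → ℝ} (hp : ∀ i, |p i| < π / 4) (m : ℕ) (ω : ℤ) (j : ℤ) (x : Fin 2 → ℝ) :
    ‖∫ k in zoneSq, Complex.exp (-(Complex.I * ((dot2 k x : ℝ) : ℂ))) *
        (((bgmSectorFn e₀ μ E h m ω (fermiMatsubara β j, k + p) : ℝ) : ℂ) /
          bgmDenom μ E (h - 1) (fermiMatsubara β j, k + p))‖ =
      ‖𝓕 (bgmSliceE2 μ e₀ E h m ω (fermiMatsubara β j)) (WithLp.toLp 2 fun i => x i / (2 * π))‖ := by
  have hπ := Real.pi_pos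
  have hrB : (0 : ℝ) < 3 * π / 4 := by positivity
  obtain ⟨B, hB⟩ : ∃ B : Set (Fin 2 → ℝ), B = {q | q 0 ^ 2 + q 1 ^ 2 < (3 * π / 4) ^ 2} := ⟨_, rfl⟩
  obtain ⟨G, hG⟩ : ∃ G : (Fin 2 → ℝ) → ℂ, G = fun q =>
      Complex.exp (-(Complex.I * ((dot2 (q - p) x : ℝ) : ℂ))) *
        (((bgmSectorFn e₀ μ E h m ω (fermiMatsubara β j, q) : ℝ) : ℂ) /
          bgmDenom μ E (h - 1) (fermiMatsubara β j, q)) := ⟨_, rfl⟩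
  have hGeq : (fun k => Complex.exp (-(Complex.I * ((dot2 k x : ℝ) : ℂ))) *
      (((bgmSectorFn e₀ μ E h m ω (fermiMatsubara β j, k + p) : ℝ) : ℂ) /
        bgmDenom μ E (h - 1) (fermiMatsubara β j, k + p))) = fun k => G (k + p) := by
    funext k; simp only [hG, add_sub_cancel_right]
  have hshell : ∀ q, G q ≠ 0 → bgmShell e₀ μ E h (fermiMatsubara β j, q) ≠ 0 := by
    intro q hq hf
    apply hq
    simp only [hG, bgmSectorFn, hf, zero_mul, Complex.ofReal_zero, zero_div, mul_zero]
  have hstep1 : (∫ k in zoneSq, G (k + p)) = ∫ q, B.indicator G q := by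
    refine setIntegral_zoneSq_comp_add_eq G p B (fun q hq hGq => ?_) (fun q hq => ?_)
    · have hb := sq_add_sq_lt_of_bgmShell_ne_zero_of_sub_mem hI hS he hh₁ hh₀ hU hUh hμ₁ hK₀ hgap hp hq
        (hshell q hGq)
      rw [hB]; simp only [Set.mem_setOf_eq]
      refine lt_trans hb ?_
      nlinarith
    · rw [hB] at hq; simp only [Set.mem_setOf_eq] at hq
      intro i _
      have hqi := abs_apply_lt_of_sq_add_sq_lt hrB.le hq i
      have hpi := hp i
      simp only [Pi.sub_apply, Set.mem_Icc]
      constructor <;> linarith [(abs_lt.1 hqi).1, (abs_lt.1 hqi).2, (abs_lt.1 hpi).1, (abs_lt.1 hpi).2]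
  rw [hGeq, hstep1]
  -- `1_B G = e^{ip⃗·x⃗} · (e^{-iq⃗·x⃗} 1_B F/D)`
  have hind : (fun q => B.indicator G q) = fun q => Complex.exp (Complex.I * ((dot2 p x : ℝ) : ℂ)) *
      (Complex.exp (-(Complex.I * ((dot2 q x : ℝ) : ℂ))) * bgmSliceFn μ e₀ E h m ω (fermiMatsubara β j) q) := by
    funext q
    rw [bgmSliceFn, ← hB]
    by_cases hq : q ∈ B
    · rw [Set.indicator_of_mem hq, Set.indicator_of_mem hq, hG]
      simp only
      rw [← mul_assoc, ← Complex.exp_add]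
      congr 2
      simp only [dot2, Pi.sub_apply]
      push_cast
      ring
    · rw [Set.indicator_of_notMem hq, Set.indicator_of_notMem hq, mul_zero, mul_zero]
  rw [hind, integral_const_mul, norm_mul, mul_comm Complex.I, Complex.norm_exp_ofReal_mul_I, one_mul]
  -- the Fourier integral on the Euclidean plane, transferred to `Fin 2 → ℝ`
  congr 1
  rw [Real.fourier_eq', ← (PiLp.volume_preserving_toLp (Fin 2)).integral_comp
    (MeasurableEquiv.toLp 2 (Fin 2 → ℝ)).measurableEmbedding]
  refine integral_congr_ae (ae_of_all _ fun q => ?_)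
  simp only [bgmSliceE2, smul_eq_mul]
  congr 1
  rw [inner_E2]
  congr 1
  simp only [dot2]
  push_cast
  field_simp

/-- **Decay of one slice in a direction `v`, every scale, uniformly in `β`**:
`|v·x⃗|^N |∫ e^{-ik⃗·x⃗}F/D| ≤ ‖∂ᵥ^N(1_B F/D)‖_{L¹}` (N integrations by parts in the direction `v`). [cite: BenfattoGiulianiMastropietro2006, §2.5 proof of Lemma 2.2 p0010:L146–L154, Lemma 2.3 p0011:L133–L140] -/
theorem pow_dot_mul_norm_sliceIntegral_le (hI : BGMInitial E) (hS : BGMSmoothness β U C hβ E) (he : 0 < e₀)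
    (he4 : e₀ < μ + 4) (hh₁ : hβ ≤ h) (hh₀ : h ≤ 0) (hU : |U| ≤ c₀) (hUh : |U| * |(hβ : ℝ)| ≤ c₀)
    (hμ₁ : -4 < μ) (hK₀ : |C 0| * c₀ ≤ 3 / 16 * e₀) (hgap : μ + e₀ + 2 * |C 0| * c₀ < -2 - Real.sqrt 2)
    (hgap' : 2 * |C 0| * c₀ ≤ (μ + 4 - e₀) / 2) {p : Fin 2 → ℝ} (hp : ∀ i, |p i| < π / 4) (m : ℕ) (ω : ℤ)
    (j : ℤ) (x : Fin 2 → ℝ) (v : EuclideanSpace ℝ (Fin 2)) (N : ℕ) :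
    |dot2 (WithLp.ofLp v) x| ^ N * ‖∫ k in zoneSq, Complex.exp (-(Complex.I * ((dot2 k x : ℝ) : ℂ))) *
        (((bgmSectorFn e₀ μ E h m ω (fermiMatsubara β j, k + p) : ℝ) : ℂ) /
          bgmDenom μ E (h - 1) (fermiMatsubara β j, k + p))‖ ≤
      ∫ y, ‖iteratedFDeriv ℝ N (bgmSliceE2 μ e₀ E h m ω (fermiMatsubara β j)) y (fun _ => v)‖ := by
  have hπ := Real.pi_pos
  rw [norm_sliceIntegral_eq_norm_fourier hI hS he hh₁ hh₀ hU hUh hμ₁ hK₀ hgap hp m ω j x]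
  have hf := contDiff_bgmSliceE2 hI hS he he4 hh₁ hh₀ hU hUh hμ₁ hK₀ hgap hgap' m ω j (n := (⊤ : ℕ∞))
  have hsupp := hasCompactSupport_bgmSliceE2 hI hS he hh₁ hh₀ hU hUh hμ₁ hK₀ hgap m ω j
  have h1 := Literature.Analysis.Fourier.pow_inner_mul_norm_fourier_le hf hsupp v
    (WithLp.toLp 2 fun i => x i / (2 * π)) N
  have hinner : inner ℝ v (WithLp.toLp 2 fun i => x i / (2 * π)) = (2 * π)⁻¹ * dot2 (WithLp.ofLp v) x := by
    rw [inner_E2]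
    simp only [dot2]
    field_simp
  rw [hinner, abs_mul, abs_of_pos (by positivity : (0 : ℝ) < (2 * π)⁻¹), mul_pow, mul_assoc] at h1
  have h2 := le_of_mul_le_mul_left h1 (by positivity)
  refine h2.trans (le_of_eq (integral_congr_ae (ae_of_all _ fun y => ?_)))
  simp only [Literature.Analysis.Fourier.iterate_dirDeriv_eq_iteratedFDeriv hf]

/-- **Decay in `x⃗` of one slice, every scale, uniformly in `β`**: `|xᵢ|^N |∫ e^{-ik⃗·x⃗}F/D| ≤ ‖∂ᵢ^N(1_B F/D)‖_{L¹}`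
(N integrations by parts in the direction `eᵢ`). [cite: BenfattoGiulianiMastropietro2006, §2.5 proof of Lemma 2.2 p0010:L146–L154, Lemma 2.3 p0011:L133–L140] -/
theorem pow_mul_norm_sliceIntegral_le (hI : BGMInitial E) (hS : BGMSmoothness β U C hβ E) (he : 0 < e₀)
    (he4 : e₀ < μ + 4) (hh₁ : hβ ≤ h) (hh₀ : h ≤ 0) (hU : |U| ≤ c₀) (hUh : |U| * |(hβ : ℝ)| ≤ c₀)
    (hμ₁ : -4 < μ) (hK₀ : |C 0| * c₀ ≤ 3 / 16 * e₀) (hgap : μ + e₀ + 2 * |C 0| * c₀ < -2 - Real.sqrt 2)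
    (hgap' : 2 * |C 0| * c₀ ≤ (μ + 4 - e₀) / 2) {p : Fin 2 → ℝ} (hp : ∀ i, |p i| < π / 4) (m : ℕ) (ω : ℤ)
    (j : ℤ) (x : Fin 2 → ℝ) (i : Fin 2) (N : ℕ) :
    |x i| ^ N * ‖∫ k in zoneSq, Complex.exp (-(Complex.I * ((dot2 k x : ℝ) : ℂ))) *
        (((bgmSectorFn e₀ μ E h m ω (fermiMatsubara β j, k + p) : ℝ) : ℂ) /
          bgmDenom μ E (h - 1) (fermiMatsubara β j, k + p))‖ ≤
      ∫ y, ‖iteratedFDeriv ℝ N (bgmSliceE2 μ e₀ E h m ω (fermiMatsubara β j)) y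
        (fun _ => EuclideanSpace.single i (1 : ℝ))‖ := by
  have h := pow_dot_mul_norm_sliceIntegral_le hI hS he he4 hh₁ hh₀ hU hUh hμ₁ hK₀ hgap hgap' hp m ω j x
    (EuclideanSpace.single i (1 : ℝ)) N
  have hdot : dot2 (WithLp.ofLp (EuclideanSpace.single i (1 : ℝ))) x = x i := by
    rw [EuclideanSpace.single, PiLp.ofLp_single]
    fin_cases i <;> simp [dot2]
  rwa [hdot] at h

/-- **The frequency count, uniform in `β`**: if every `j ∈ S` has `|k₀(j)| ≤ R` then `(1/β)·#S ≤ 4R/π`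
(if `S ≠ ∅` then `π/β ≤ R`). [cite: BenfattoGiulianiMastropietro2006, §2.3 (2.31a) p0007:L137] -/
private theorem inv_beta_mul_card_le {β R : ℝ} (hβ : 0 < β) (hR : 0 ≤ R) (S : Finset ℤ)
    (hS : ∀ j ∈ S, |fermiMatsubara β j| ≤ R) : 1 / β * (S.card : ℝ) ≤ 4 * R / π := by
  rcases S.eq_empty_or_nonempty with hSe | ⟨j, hj⟩
  · rw [hSe, Finset.card_empty, Nat.cast_zero, mul_zero]; positivity
  · have h1 : π / β ≤ R := (pi_div_le_abs_fermiMatsubara hβ j).trans (hS j hj)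
    have hcard := card_fermiMatsubara_le hβ hR S hS
    have h3 : (3 : ℝ) ≤ 3 * (R * β / π) := by
      rw [div_le_iff₀ hβ] at h1
      have : 1 ≤ R * β / π := by rw [le_div_iff₀ Real.pi_pos]; linarith
      linarith
    have h4 : (S.card : ℝ) ≤ 4 * (R * β / π) := by linarith
    calc 1 / β * (S.card : ℝ) ≤ 1 / β * (4 * (R * β / π)) :=
          mul_le_mul_of_nonneg_left h4 (by positivity)
      _ = 4 * R / π := by field_simp

/-- A finite Matsubara box containing every frequency with `|k₀| ≤ R`, all of whose members satisfy
`|k₀| ≤ R`. [folklore] -/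
private theorem exists_matsubara_box (hβ : 0 < β) (R : ℝ) :
    ∃ S : Finset ℤ, (∀ j ∈ S, |fermiMatsubara β j| ≤ R) ∧ (∀ j, |fermiMatsubara β j| ≤ R → j ∈ S) := by
  refine ⟨(Finset.Icc (-(⌈R * β / (2 * π)⌉₊ : ℤ)) (⌈R * β / (2 * π)⌉₊ : ℤ)).filter
      fun j => |fermiMatsubara β j| ≤ R,
    fun j hj => (Finset.mem_filter.1 hj).2, fun j hj => ?_⟩
  exact Finset.mem_filter.2 ⟨natAbs_le_of_abs_fermiMatsubara_le hβ hj, hj⟩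

/-- The unit coordinate vector has sup-norm `1`. [folklore] -/
private theorem norm_ofLp_single_le (i : Fin 2) : ‖WithLp.ofLp (EuclideanSpace.single i (1 : ℝ))‖ ≤ 1 := by
  rw [EuclideanSpace.single, PiLp.ofLp_single, Pi.norm_single, norm_one]

/-- **Decay in `x⃗` of the general sector propagator (2.49)/(2.59), every scale, uniformly in `β`**: under
(2.36) with the coupled smallness, for every angular index `m` with `γ^h ≤ w_m` (anisotropic `m = n` and
isotropic `m = 2n` alike), every sector and every `N`:
`(γ^h|xᵢ|)^N |g(x₀, x⃗)| ≤ K γ^h w_m`. [cite: BenfattoGiulianiMastropietro2006, §2.5 proof of Lemma 2.2 p0010:L146–p0011:L7, Lemma 2.3 (2.60) p0011:L133–L140] -/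
theorem exists_xpow_mul_norm_bgmGenProp_le {μ e₀ : ℝ} (hμ₁ : -4 < μ) (he : 0 < e₀) (he4 : e₀ < μ + 4)
    (C : ℕ → ℝ) (N : ℕ) {c₀ : ℝ} (hc₁ : c₀ ≤ 1) :
    ∃ K : ℝ, 0 ≤ K ∧ ∀ (β U : ℝ) (hβ : ℤ) (E : ℤ → ℝ × (Fin 2 → ℝ) → ℂ), 0 < β →
      BGMInitial E → BGMSymmetry E → BGMSmoothness β U C hβ E → |U| ≤ c₀ → |U| * |(hβ : ℝ)| ≤ c₀ →
      |C 0| * c₀ ≤ 3 / 16 * e₀ → 2 * |C 1| * c₀ ^ 2 ≤ 1 / 2 →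
      2 * (4 * |C 2| * c₀ ^ 2) * (2 * |C 0| * c₀ + 2 * e₀) ≤ 1 →
      μ + e₀ + 2 * |C 0| * c₀ < -2 - Real.sqrt 2 → 2 * |C 0| * c₀ ≤ (μ + 4 - e₀) / 2 →
      2 * (2 * |C 1| * c₀ ^ 2) ≤ 2 / π * Real.sqrt ((μ + 4 - e₀) / 2) →
      ∀ h : ℤ, hβ ≤ h → h ≤ 0 → ∀ (m ω : ℕ), ω < sectorCount m → (4 : ℝ) ^ h ≤ sectorWidth m →
      ∀ (x₀ : ℝ) (x : Fin 2 → ℤ) (i : Fin 2),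
      ((4 : ℝ) ^ h * |(x i : ℝ)|) ^ N * ‖bgmGenProp β e₀ μ E h m ω x₀ x‖ ≤ K * (4 : ℝ) ^ h * sectorWidth m := by
  have hπ := Real.pi_pos
  obtain ⟨KL, hKL0, hKL⟩ := exists_integral_norm_iteratedFDeriv_bgmSliceE2_le hμ₁ he he4 C N hc₁
  refine ⟨32 * e₀ / π * KL / (2 * π) ^ 2, by positivity,
    fun β U hβ E hβpos hI hSy hS hU hUh hK₀ hK₁ hK₂' hgap hgap' hδ₁ h hh₁ hh₀ m ω hω hwm x₀ x i => ?_⟩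
  have h4 : (0 : ℝ) < (4 : ℝ) ^ h := zpow_pos (by norm_num) _
  have hw := sectorWidth_pos m
  obtain ⟨S, hSR, hmem⟩ := exists_matsubara_box hβpos (8 * e₀ * (4 : ℝ) ^ h)
  have hpFi : ∀ i, |(levelRadius (bgmEffDisp β E h) μ (sectorCenter m ω) • dir (sectorCenter m ω)) i| < π / 4 :=
    abs_fermiPoint_apply_lt hI hS hh₁ hh₀ hU hUh he hgap hgap' he4 hδ₁ _
  rw [bgmGenProp_eq_sum hI hSy hS he hβpos hh₁ hh₀ hU hUh hK₀ hK₁ hK₂' m ω x₀ x hmem, norm_mul,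
    Complex.norm_real, Real.norm_eq_abs, abs_of_pos (by positivity : (0 : ℝ) < 1 / β)]
  -- each slice: `|x_i|^N ‖S_j‖ ≤ KL w_m γ^{-Nh}`
  have hterm : ∀ j' ∈ S, |(x i : ℝ)| ^ N *
      ‖Complex.exp (-(Complex.I * ((π * (2 * (j' : ℝ) + 1) / β * x₀ : ℝ) : ℂ))) •
        ((∫ k in zoneSq, Complex.exp (-(Complex.I * ((dot2 k (fun i => (x i : ℝ)) : ℝ) : ℂ))) *
          (((bgmSectorFn e₀ μ E h m ω
              (fermiMatsubara β j', k + levelRadius (bgmEffDisp β E h) μ (sectorCenter m ω) •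
                dir (sectorCenter m ω)) : ℝ) : ℂ) /
            bgmDenom μ E (h - 1)
              (fermiMatsubara β j', k + levelRadius (bgmEffDisp β E h) μ (sectorCenter m ω) •
                dir (sectorCenter m ω)))) /
          (((2 * π) ^ 2 : ℝ) : ℂ))‖ ≤ KL * sectorWidth m * (4 : ℝ) ^ (-((N : ℤ) * h)) / (2 * π) ^ 2 := by
    intro j' _
    rw [norm_smul, Literature.Analysis.Fourier.norm_cexp_neg_I_mul_ofReal, one_mul, norm_div, Complex.norm_real,
      Real.norm_eq_abs, abs_of_pos (by positivity : (0 : ℝ) < (2 * π) ^ 2), ← mul_div_assoc]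
    refine div_le_div_of_nonneg_right ?_ (by positivity)
    refine (pow_mul_norm_sliceIntegral_le hI hS he he4 hh₁ hh₀ hU hUh hμ₁ hK₀ hgap hgap' hpFi m ω j'
      (fun i => (x i : ℝ)) i N).trans ?_
    exact hKL β U hβ E hI hS hU hUh hK₀ hgap hgap' hδ₁ h hh₁ hh₀ m ω hω hwm j' _ (norm_ofLp_single_le i)
  have hβS := inv_beta_mul_card_le hβpos (by positivity) S hSR
  -- sum up
  have hsum : |(x i : ℝ)| ^ N * ‖∑ j' ∈ S, Complex.exp (-(Complex.I * ((π * (2 * (j' : ℝ) + 1) / β * x₀ : ℝ) : ℂ))) •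
        ((∫ k in zoneSq, Complex.exp (-(Complex.I * ((dot2 k (fun i => (x i : ℝ)) : ℝ) : ℂ))) *
          (((bgmSectorFn e₀ μ E h m ω
              (fermiMatsubara β j', k + levelRadius (bgmEffDisp β E h) μ (sectorCenter m ω) •
                dir (sectorCenter m ω)) : ℝ) : ℂ) /
            bgmDenom μ E (h - 1)
              (fermiMatsubara β j', k + levelRadius (bgmEffDisp β E h) μ (sectorCenter m ω) •
                dir (sectorCenter m ω)))) /
          (((2 * π) ^ 2 : ℝ) : ℂ))‖ ≤
      S.card * (KL * sectorWidth m * (4 : ℝ) ^ (-((N : ℤ) * h)) / (2 * π) ^ 2) := by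
    refine (mul_le_mul_of_nonneg_left (norm_sum_le _ _) (by positivity)).trans ?_
    rw [Finset.mul_sum]
    refine (Finset.sum_le_sum hterm).trans (le_of_eq ?_)
    rw [Finset.sum_const, nsmul_eq_mul]
  have hxN : ((4 : ℝ) ^ h * |(x i : ℝ)|) ^ N = (4 : ℝ) ^ ((N : ℤ) * h) * |(x i : ℝ)| ^ N := by
    rw [mul_pow, ← zpow_natCast, ← zpow_mul, mul_comm h]
  rw [hxN]
  have hNN : (4 : ℝ) ^ ((N : ℤ) * h) * (4 : ℝ) ^ (-((N : ℤ) * h)) = 1 := by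
    rw [zpow_neg]; exact mul_inv_cancel₀ (zpow_pos (by norm_num) _).ne'
  calc (4 : ℝ) ^ ((N : ℤ) * h) * |(x i : ℝ)| ^ N * (1 / β * ‖∑ j' ∈ S, _‖)
      = (4 : ℝ) ^ ((N : ℤ) * h) * (1 / β) * (|(x i : ℝ)| ^ N * ‖∑ j' ∈ S, _‖) := by ring
    _ ≤ (4 : ℝ) ^ ((N : ℤ) * h) * (1 / β) * (S.card * (KL * sectorWidth m * (4 : ℝ) ^ (-((N : ℤ) * h)) /
          (2 * π) ^ 2)) := mul_le_mul_of_nonneg_left hsum (by positivity)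
    _ = ((4 : ℝ) ^ ((N : ℤ) * h) * (4 : ℝ) ^ (-((N : ℤ) * h))) * (1 / β * S.card) *
          (KL * sectorWidth m / (2 * π) ^ 2) := by ring
    _ ≤ 1 * (4 * (8 * e₀ * (4 : ℝ) ^ h) / π) * (KL * sectorWidth m / (2 * π) ^ 2) := by
        rw [hNN]; gcongr
    _ = 32 * e₀ / π * KL / (2 * π) ^ 2 * (4 : ℝ) ^ h * sectorWidth m := by ring

end Fourier

/-! ### §3 The time side: the decay in `x₀` through `d_β` ((2.52) with (2.36c)) -/

section Time

variable {μ e₀ β U c₀ : ℝ} {C : ℕ → ℝ} {hβ : ℤ} {E : ℤ → ℝ × (Fin 2 → ℝ) → ℂ} {h : ℤ}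

/-- **Backward differences through forward differences**: `Δ_{-1}^N F(y) = (-1)^N Δ_1^N F(y - N)`. [folklore] -/
private theorem fwdDiff_neg_one_iter_eq (F : ℤ → ℂ) (N : ℕ) (y : ℤ) :
    (fwdDiff (-1 : ℤ))^[N] F y = (-1 : ℂ) ^ N * (fwdDiff (1 : ℤ))^[N] F (y - N) := by
  have hR : (fwdDiff (1 : ℤ))^[N] F (y - N) =
      ∑ k ∈ Finset.range (N + 1), (((-1 : ℤ) ^ k * (N.choose k : ℕ) : ℤ) : ℂ) * F (y - k) := by
    rw [fwdDiff_iter_eq_sum_shift, ← Finset.sum_range_reflect]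
    refine Finset.sum_congr rfl fun k hk => ?_
    have hkN : k ≤ N := by have := Finset.mem_range.1 hk; omega
    rw [show N + 1 - 1 - k = N - k by omega, Nat.choose_symm hkN, Nat.sub_sub_self hkN, zsmul_eq_mul,
      nsmul_eq_mul, mul_one, Nat.cast_sub hkN]
    congr 1
    ring_nf
  have hL : (fwdDiff (-1 : ℤ))^[N] F y =
      ∑ k ∈ Finset.range (N + 1), (((-1 : ℤ) ^ (N - k) * (N.choose k : ℕ) : ℤ) : ℂ) * F (y - k) := by
    rw [fwdDiff_iter_eq_sum_shift]
    refine Finset.sum_congr rfl fun k _ => ?_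
    rw [zsmul_eq_mul, nsmul_eq_mul, mul_neg, mul_one, ← sub_eq_add_neg]
  rw [hL, hR, Finset.mul_sum]
  refine Finset.sum_congr rfl fun k hk => ?_
  have hkN : k ≤ N := by have := Finset.mem_range.1 hk; omega
  push_cast
  rw [show ((-1 : ℂ)) ^ (N - k) = (-1) ^ N * (-1) ^ k by
    rw [← pow_add, show N + k = (N - k) + 2 * k by omega, pow_add, pow_mul]; norm_num]
  ring

/-- Hence `‖Δ_{-1}^N F(y)‖ = ‖Δ_1^N F(y - N)‖`. [folklore] -/
private theorem norm_fwdDiff_neg_one_iter (F : ℤ → ℂ) (N : ℕ) (y : ℤ) :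
    ‖(fwdDiff (-1 : ℤ))^[N] F y‖ = ‖(fwdDiff (1 : ℤ))^[N] F (y - N)‖ := by
  rw [fwdDiff_neg_one_iter_eq, norm_mul, norm_pow, norm_neg, norm_one, one_pow, one_mul]

/-- The polar angle of a ray point: `θ(ρe⃗_r(θ)) = θ` for `ρ > 0`, `θ ∈ (-π, π]`. [folklore] -/
private theorem polarAngle_smul_dir {ρ θ : ℝ} (hρ : 0 < ρ) (hθ : θ ∈ Ioc (-π) π) :
    polarAngle (ρ • dir θ) = θ := by
  unfold polarAngle
  have : momToComplex (ρ • dir θ) = ρ * (Complex.cos θ + Complex.sin θ * Complex.I) := by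
    apply Complex.ext <;> simp [momToComplex, Complex.cos_ofReal_re, Complex.sin_ofReal_re]
  rw [this]
  exact Complex.arg_mul_cos_add_sin_mul_I hρ hθ

/-- The slice integrand `q⃗ ↦ F_{h,ω}(k₀, q⃗)/D_{h-1}(k₀, q⃗)` is measurable. [folklore] -/
private theorem measurable_slice (hS : BGMSmoothness β U C hβ E) (e₀ μ : ℝ) (h' : ℤ) (m : ℕ) (ω : ℤ) (k₀ : ℝ) :
    Measurable fun q : Fin 2 → ℝ => ((bgmSectorFn e₀ μ E h' m ω (k₀, q) : ℝ) : ℂ) /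
      bgmDenom μ E (h' - 1) (k₀, q) := by
  have hc : ∀ h'' : ℤ, Continuous fun q : Fin 2 → ℝ => E h'' (k₀, q) := fun h'' => (hS.1 h'' k₀ 0).continuous
  have hD : ∀ h'' : ℤ, Continuous fun q : Fin 2 → ℝ => bgmDenom μ E h'' (k₀, q) := fun h'' => by
    simp only [bgmDenom]
    exact continuous_const.add ((hc h'').sub continuous_const)
  have hsh : Continuous fun q : Fin 2 → ℝ => bgmShell e₀ μ E h' (k₀, q) := by
    simp only [bgmShell, bgmCutoffInv]
    exact ((contDiff_gnScaleCutoff 4 e₀ h' (m := 0)).continuous.comp (hD h').norm).sub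
      ((contDiff_gnScaleCutoff 4 e₀ (h' - 1) (m := 0)).continuous.comp (hD (h' - 1)).norm)
  have hζ : Measurable fun q : Fin 2 → ℝ => sectorWeightCirc m ω (polarAngle q) :=
    (contDiff_sectorWeightCirc m ω (m := 0)).continuous.measurable.comp
      (Complex.measurable_arg.comp (contDiff_momToComplex (m := 0)).continuous.measurable)
  simp only [bgmSectorFn]
  simp_rw [div_eq_mul_inv]
  exact (Complex.measurable_ofReal.comp (hsh.measurable.mul hζ)).mul (hD (h' - 1)).measurable.inv

/-- The period cell has finite measure. [folklore] -/
private theorem volume_zoneSq_lt_top : volume zoneSq < ⊤ := by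
  unfold zoneSq
  exact (isCompact_univ_pi fun _ => isCompact_Icc).measure_lt_top

/-- The phase is continuous. [folklore] -/
private theorem continuous_phase (x p : Fin 2 → ℝ) :
    Continuous fun q : Fin 2 → ℝ => Complex.exp (-(Complex.I * ((dot2 (q - p) x : ℝ) : ℂ))) := by
  refine Complex.continuous_exp.comp (Continuous.neg (continuous_const.mul (Complex.continuous_ofReal.comp ?_)))
  simp only [dot2]
  fun_prop

/-- The shifted slice with the phase is integrable on the period cell (bounded and measurable).
[cite: BenfattoGiulianiMastropietro2006, §2.5 proof of Lemma 2.2 p0011:L5–L7] -/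
private theorem integrableOn_phase_mul_slice (hS : BGMSmoothness β U C hβ E) (he : 0 < e₀) (hh₁ : hβ ≤ h)
    (hh₀ : h ≤ 0) (hU : |U| ≤ c₀) (hUh : |U| * |(hβ : ℝ)| ≤ c₀) (hK₀ : |C 0| * c₀ ≤ 3 / 16 * e₀) (m : ℕ)
    (ω : ℤ) (j : ℤ) (p x : Fin 2 → ℝ) (a : ℂ) :
    IntegrableOn (fun k : Fin 2 → ℝ => Complex.exp (-(Complex.I * ((dot2 k x : ℝ) : ℂ))) *
      (a * (((bgmSectorFn e₀ μ E h m ω (fermiMatsubara β j, k + p) : ℝ) : ℂ) /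
        bgmDenom μ E (h - 1) (fermiMatsubara β j, k + p)))) zoneSq := by
  have hmeas : Measurable fun k : Fin 2 → ℝ => Complex.exp (-(Complex.I * ((dot2 k x : ℝ) : ℂ))) *
      (a * (((bgmSectorFn e₀ μ E h m ω (fermiMatsubara β j, k + p) : ℝ) : ℂ) /
        bgmDenom μ E (h - 1) (fermiMatsubara β j, k + p))) := by
    have h1 := continuous_phase x 0
    simp only [sub_zero] at h1
    exact h1.measurable.mul (measurable_const.mul
      ((measurable_slice hS e₀ μ h m ω (fermiMatsubara β j)).comp (measurable_add_const p)))
  refine IntegrableOn.of_bound volume_zoneSq_lt_top hmeas.aestronglyMeasurable (‖a‖ * (16 * (4 : ℝ) ^ (-h) / e₀))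
    (Eventually.of_forall fun k => ?_)
  rw [norm_mul, Literature.Analysis.Fourier.norm_cexp_neg_I_mul_ofReal, one_mul, norm_mul]
  exact mul_le_mul_of_nonneg_left (norm_sectorIntegrand_le (μ := μ) hS he hh₁ hh₀ hU hUh hK₀ m ω j (k + p))
    (norm_nonneg _)

/-- **The `N`-th Matsubara difference of the slice integrals is the integral of the `N`-th difference of
the slices** (linearity). [cite: BenfattoGiulianiMastropietro2006, §2.5 proof of Lemma 2.2 (2.36c) p0010:L155–L160] -/
theorem fwdDiff_iter_sliceIntegral (hS : BGMSmoothness β U C hβ E) (he : 0 < e₀) (hh₁ : hβ ≤ h) (hh₀ : h ≤ 0)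
    (hU : |U| ≤ c₀) (hUh : |U| * |(hβ : ℝ)| ≤ c₀) (hK₀ : |C 0| * c₀ ≤ 3 / 16 * e₀) (m : ℕ) (ω : ℤ)
    (p x : Fin 2 → ℝ) (N : ℕ) (j₀ : ℤ) :
    (fwdDiff (1 : ℤ))^[N] (fun j : ℤ => ∫ k in zoneSq, Complex.exp (-(Complex.I * ((dot2 k x : ℝ) : ℂ))) *
        (((bgmSectorFn e₀ μ E h m ω (fermiMatsubara β j, k + p) : ℝ) : ℂ) /
          bgmDenom μ E (h - 1) (fermiMatsubara β j, k + p))) j₀ =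
      ∫ k in zoneSq, Complex.exp (-(Complex.I * ((dot2 k x : ℝ) : ℂ))) *
        (fwdDiff (1 : ℤ))^[N] (fun j : ℤ => ((bgmSectorFn e₀ μ E h m ω (fermiMatsubara β j, k + p) : ℝ) : ℂ) /
          bgmDenom μ E (h - 1) (fermiMatsubara β j, k + p)) j₀ := by
  rw [fwdDiff_iter_eq_sum_shift]
  simp only [fwdDiff_iter_eq_sum_shift, Finset.mul_sum]
  rw [integral_finsetSum _ fun k _ => ?_]
  · refine Finset.sum_congr rfl fun k _ => ?_
    rw [zsmul_eq_mul, ← integral_const_mul]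
    refine setIntegral_congr_fun (by unfold zoneSq; exact MeasurableSet.univ_pi fun _ => measurableSet_Icc)
      fun q _ => ?_
    simp only [zsmul_eq_mul, nsmul_eq_mul, mul_one]
    ring
  · simp only [zsmul_eq_mul, nsmul_eq_mul, mul_one]
    exact integrableOn_phase_mul_slice hS he hh₁ hh₀ hU hUh hK₀ m ω (j₀ + k) p x _

/-- **The integral of the `N`-th Matsubara difference of the slices is small**: sup (the time export of
`BGM2006Sec2ShellLineBounds`, `‖Δ^N(F/D)‖ ≤ M_t`) times the measure of the support (the union of the
`N + 1` support windows of the frequencies involved, each of measure `≲ w_m e₀γ^h/c`).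
[cite: BenfattoGiulianiMastropietro2006, §2.5 proof of Lemma 2.2 (2.36c) p0010:L155–p0011:L7] -/
theorem norm_integral_fwdDiff_slice_le (hI : BGMInitial E) (hS : BGMSmoothness β U C hβ E) (he : 0 < e₀)
    (hh₁ : hβ ≤ h) (hh₀ : h ≤ 0) (hU : |U| ≤ c₀) (hUh : |U| * |(hβ : ℝ)| ≤ c₀) (hμ₁ : -4 < μ)
    (hK₀ : |C 0| * c₀ ≤ 3 / 16 * e₀) (hgap : μ + e₀ + 2 * |C 0| * c₀ < -2 - Real.sqrt 2)
    (hgap' : 2 * |C 0| * c₀ ≤ (μ + 4 - e₀) / 2) (he4 : e₀ < μ + 4)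
    (hδ₁ : 2 * (2 * |C 1| * c₀ ^ 2) ≤ 2 / π * Real.sqrt ((μ + 4 - e₀) / 2))
    {p : Fin 2 → ℝ} (hp : ∀ i, |p i| < π / 4) (m : ℕ) {ω : ℕ} (hω : ω < sectorCount m) (x : Fin 2 → ℝ)
    (N : ℕ) {Mt : ℝ} (hMt0 : 0 ≤ Mt)
    (hMt : ∀ (j₀ : ℤ) (q : Fin 2 → ℝ), ‖(fwdDiff (1 : ℤ))^[N] (fun j : ℤ =>
      ((bgmSectorFn e₀ μ E h m ω (fermiMatsubara β j, q) : ℝ) : ℂ) / bgmDenom μ E (h - 1) (fermiMatsubara β j, q)) j₀‖ ≤ Mt)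
    (j₀ : ℤ) :
    ‖∫ k in zoneSq, Complex.exp (-(Complex.I * ((dot2 k x : ℝ) : ℂ))) *
        (fwdDiff (1 : ℤ))^[N] (fun j : ℤ => ((bgmSectorFn e₀ μ E h m ω (fermiMatsubara β j, k + p) : ℝ) : ℂ) /
          bgmDenom μ E (h - 1) (fermiMatsubara β j, k + p)) j₀‖ ≤
      (N + 1) * (6 * (3 * sectorWidth m / 4) * (π / 4 * Mt *
        (2 * (e₀ * (4 : ℝ) ^ h / (2 / π * Real.sqrt ((μ + 4 - e₀) / 2)))))) := by
  have hπ := Real.pi_pos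
  have hrB : (0 : ℝ) < 3 * π / 4 := by positivity
  have h4 : (0 : ℝ) < (4 : ℝ) ^ h := zpow_pos (by norm_num) _
  have hc0 : 0 < Real.sqrt ((μ + 4 - e₀) / 2) := Real.sqrt_pos.2 (by linarith)
  have hw := sectorWidth_pos m
  obtain ⟨B, hB⟩ : ∃ B : Set (Fin 2 → ℝ), B = {q | q 0 ^ 2 + q 1 ^ 2 < (3 * π / 4) ^ 2} := ⟨_, rfl⟩
  -- the slices `Φ j` and their `N`-th difference `D`
  obtain ⟨Φ, hΦ⟩ : ∃ Φ : ℤ → (Fin 2 → ℝ) → ℂ, Φ = fun j q =>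
      ((bgmSectorFn e₀ μ E h m ω (fermiMatsubara β j, q) : ℝ) : ℂ) / bgmDenom μ E (h - 1) (fermiMatsubara β j, q) :=
    ⟨_, rfl⟩
  obtain ⟨D, hD⟩ : ∃ D : (Fin 2 → ℝ) → ℂ, D = fun q => (fwdDiff (1 : ℤ))^[N] (fun j : ℤ => Φ j q) j₀ := ⟨_, rfl⟩
  have hDsum : ∀ q, D q = ∑ k ∈ Finset.range (N + 1),
      (((-1 : ℤ) ^ (N - k) * (N.choose k : ℕ) : ℤ) : ℂ) * Φ (j₀ + k) q := fun q => by
    rw [hD]; simp only [fwdDiff_iter_eq_sum_shift, zsmul_eq_mul, nsmul_eq_mul, mul_one]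
  have hΦshell : ∀ j q, Φ j q ≠ 0 → bgmShell e₀ μ E h (fermiMatsubara β j, q) ≠ 0 ∧
      sectorWeightCirc m ω (polarAngle q) ≠ 0 := by
    intro j q hq
    rw [hΦ] at hq
    refine ⟨fun hf => hq ?_, fun hz => hq ?_⟩
    · simp [bgmSectorFn, hf]
    · simp [bgmSectorFn, hz]
  have hDne : ∀ q, D q ≠ 0 → ∃ k ∈ Finset.range (N + 1), Φ (j₀ + k) q ≠ 0 := by
    intro q hq
    by_contra hnone
    push Not at hnone
    apply hq
    rw [hDsum]
    exact Finset.sum_eq_zero fun k hk => by rw [hnone k hk, mul_zero]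
  -- the statement in terms of `D`
  have hgoal : (fun k : Fin 2 → ℝ => Complex.exp (-(Complex.I * ((dot2 k x : ℝ) : ℂ))) *
      (fwdDiff (1 : ℤ))^[N] (fun j : ℤ => ((bgmSectorFn e₀ μ E h m ω (fermiMatsubara β j, k + p) : ℝ) : ℂ) /
        bgmDenom μ E (h - 1) (fermiMatsubara β j, k + p)) j₀) =
      fun k => (fun q => Complex.exp (-(Complex.I * ((dot2 (q - p) x : ℝ) : ℂ))) * D q) (k + p) := by
    funext k; simp only [hD, hΦ, add_sub_cancel_right]
  rw [hgoal]
  -- translation to the disc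
  have hstep1 : (∫ k in zoneSq, (fun q => Complex.exp (-(Complex.I * ((dot2 (q - p) x : ℝ) : ℂ))) * D q) (k + p)) =
      ∫ q, B.indicator (fun q => Complex.exp (-(Complex.I * ((dot2 (q - p) x : ℝ) : ℂ))) * D q) q := by
    refine setIntegral_zoneSq_comp_add_eq
      (fun q => Complex.exp (-(Complex.I * ((dot2 (q - p) x : ℝ) : ℂ))) * D q) p B
      (fun q hq hGq => ?_) (fun q hq => ?_)
    · have hDq : D q ≠ 0 := fun h0 => hGq (by rw [h0, mul_zero])
      obtain ⟨k, -, hk⟩ := hDne q hDq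
      have hb := sq_add_sq_lt_of_bgmShell_ne_zero_of_sub_mem hI hS he hh₁ hh₀ hU hUh hμ₁ hK₀ hgap hp hq
        (hΦshell _ q hk).1
      rw [hB]; simp only [Set.mem_setOf_eq]
      refine lt_trans hb ?_
      nlinarith
    · rw [hB] at hq; simp only [Set.mem_setOf_eq] at hq
      intro i _
      have hqi := abs_apply_lt_of_sq_add_sq_lt hrB.le hq i
      have hpi := hp i
      simp only [Pi.sub_apply, Set.mem_Icc]
      constructor <;> linarith [(abs_lt.1 hqi).1, (abs_lt.1 hqi).2, (abs_lt.1 hpi).1, (abs_lt.1 hpi).2]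
  rw [hstep1]
  have hnorm : ‖∫ q, B.indicator (fun q => Complex.exp (-(Complex.I * ((dot2 (q - p) x : ℝ) : ℂ))) * D q) q‖ ≤
      ∫ q, B.indicator (fun q => ‖D q‖) q := by
    refine (norm_integral_le_integral_norm _).trans (le_of_eq ?_)
    congr 1; funext q
    rw [norm_indicator_eq_indicator_norm]
    congr 1; funext q'
    rw [norm_mul, Literature.Analysis.Fourier.norm_cexp_neg_I_mul_ofReal, one_mul]
  refine hnorm.trans ?_
  -- the majorant: a sum of `N + 1` indicator functions
  obtain ⟨g, hg⟩ : ∃ g : ℕ → (Fin 2 → ℝ) → ℝ, g = fun k : ℕ =>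
      ((fun q => Φ (j₀ + (k : ℤ)) q) ⁻¹' {0}ᶜ).indicator fun _ => Mt := ⟨_, rfl⟩
  have hΦm : ∀ j, Measurable (Φ j) := fun j => by rw [hΦ]; exact measurable_slice hS e₀ μ h m ω _
  have hSk : ∀ k : ℕ, MeasurableSet ((fun q => Φ (j₀ + (k : ℤ)) q) ⁻¹' ({0}ᶜ : Set ℂ)) := fun k =>
    (hΦm _) (measurableSet_singleton 0).compl
  have hgm : ∀ k, Measurable (g k) := fun k => by rw [hg]; exact measurable_const.indicator (hSk k)
  have hg0 : ∀ k q, 0 ≤ g k q := fun k q => by rw [hg]; exact Set.indicator_nonneg (fun _ _ => hMt0) _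
  have hgM : ∀ k q, g k q ≤ Mt := fun k q => by
    rw [hg]; exact Set.indicator_le_self' (fun _ _ => hMt0) _
  have hmaj : ∀ q, ‖D q‖ ≤ ∑ k ∈ Finset.range (N + 1), g k q := by
    intro q
    by_cases hDq : D q = 0
    · rw [hDq, norm_zero]; exact Finset.sum_nonneg fun k _ => hg0 k q
    · obtain ⟨k, hk, hΦk⟩ := hDne q hDq
      have hgk : g k q = Mt := by rw [hg]; exact Set.indicator_of_mem (by exact hΦk) _
      calc ‖D q‖ ≤ Mt := by simp only [hD, hΦ]; exact hMt j₀ q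
        _ = g k q := hgk.symm
        _ ≤ ∑ k ∈ Finset.range (N + 1), g k q :=
            Finset.single_le_sum (f := fun k => g k q) (fun k _ => hg0 k q) hk
  -- finite measure of the disc and integrability of the majorant
  have hBm : MeasurableSet B := by rw [hB]; exact measurableSet_lt (by fun_prop) measurable_const
  have hBfin : volume B < ⊤ := by
    have hsub : B ⊆ Set.pi Set.univ fun _ : Fin 2 => Icc (-(3 * π / 4)) (3 * π / 4) := by
      intro q hq i _
      rw [hB] at hq
      have := abs_apply_lt_of_sq_add_sq_lt hrB.le hq i
      exact ⟨(abs_lt.1 this).1.le, (abs_lt.1 this).2.le⟩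
    exact lt_of_le_of_lt (measure_mono hsub) (isCompact_univ_pi fun _ => isCompact_Icc).measure_lt_top
  have hgint : ∀ k, Integrable (B.indicator (g k)) := fun k =>
    (IntegrableOn.of_bound hBfin (hgm k).aestronglyMeasurable Mt
      (Eventually.of_forall fun q => by rw [Real.norm_eq_abs, abs_of_nonneg (hg0 k q)]; exact hgM k q)).integrable_indicator hBm
  have hmono : ∫ q, B.indicator (fun q => ‖D q‖) q ≤ ∫ q, ∑ k ∈ Finset.range (N + 1), B.indicator (g k) q := by
    refine integral_mono_of_nonneg (Eventually.of_forall fun q => Set.indicator_nonneg (fun _ _ => norm_nonneg _) _)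
      (integrable_finsetSum _ fun k _ => hgint k) (Eventually.of_forall fun q => ?_)
    simp only
    by_cases hq : q ∈ B
    · simp only [Set.indicator_of_mem hq]; exact hmaj q
    · simp only [Set.indicator_of_notMem hq, Finset.sum_const_zero, le_refl]
  refine hmono.trans ?_
  rw [integral_finsetSum _ fun k _ => hgint k]
  -- each window integral by the polar support lemma
  have hθ₀ : sectorCenter m ω ∈ Icc 0 (2 * π) := by
    have hN := sectorCount_mul_sectorWidth m
    have hω' : (ω : ℝ) + 1 ≤ sectorCount m := by exact_mod_cast hω
    refine ⟨by unfold sectorCenter; positivity, ?_⟩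
    unfold sectorCenter
    nlinarith
  have hwa : 3 * sectorWidth m / 4 ≤ π := by linarith [sectorWidth_le_pi m]
  have heach : ∀ k ∈ Finset.range (N + 1), ∫ q, B.indicator (g k) q ≤
      6 * (3 * sectorWidth m / 4) * (π / 4 * Mt * (2 * (e₀ * (4 : ℝ) ^ h / (2 / π * Real.sqrt ((μ + 4 - e₀) / 2))))) := by
    intro k _
    rw [hB]
    refine integral_indicator_ball_le_of_support (hgm k) (hg0 k) hMt0 (hgM k) hθ₀ (by positivity) hwa
      (by positivity) (levelRadius (fun q => (E h (fermiMatsubara β (j₀ + k), q)).re) μ) fun ρ θ hρ hθ hgq => ?_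
    have hmemS : ρ • dir θ ∈ (fun q => Φ (j₀ + k) q) ⁻¹' ({0}ᶜ : Set ℂ) := by
      by_contra hnot; apply hgq; rw [hg]; exact Set.indicator_of_notMem hnot _
    have hΦne : Φ (j₀ + k) (ρ • dir θ) ≠ 0 := hmemS
    obtain ⟨hf, hζ⟩ := hΦshell _ _ hΦne
    obtain ⟨hρ4, hρu⟩ := radial_localisation hI hS he hh₁ hh₀ hU hUh hμ₁ hK₀ hgap hgap' he4 hδ₁ hρ hf
    refine ⟨hρ4, hρu, ?_⟩
    rw [polarAngle_smul_dir hρ.1 ⟨hθ.1, hθ.2.le⟩] at hζ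
    have hcos := cos_le_cos_sub_of_sectorWeightCirc_ne_zero hζ
    have hcos' : Real.cos (3 * sectorWidth m / 4) ≤ Real.cos (θ - sectorCenter m ω) := by
      rw [sectorCenter]; push_cast at hcos; exact hcos
    obtain ⟨k', hk'⟩ := exists_abs_sub_le_of_cos_le (by positivity) hwa hcos'
    exact ⟨k', hk'⟩
  refine (Finset.sum_le_sum heach).trans (le_of_eq ?_)
  rw [Finset.sum_const, Finset.card_range, nsmul_eq_mul]
  push_cast
  ring


/-- Division by a constant commutes with iterated differences. [folklore] -/
private theorem fwdDiff_iter_div_const (I : ℤ → ℂ) (c : ℂ) (N : ℕ) (y : ℤ) :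
    (fwdDiff (1 : ℤ))^[N] (fun j => I j / c) y = (fwdDiff (1 : ℤ))^[N] I y / c := by
  simp only [fwdDiff_iter_eq_sum_shift, Finset.sum_div, smul_div_assoc]

/-- **Decay in `x₀` of the general sector propagator (2.49)/(2.59), every scale, uniformly in `β`**: under
(2.36) (with (2.36c)) and the coupled smallness, for every angular index `m`, every sector and every `N`:
`(γ^h|d_β(x₀)|)^N |g(x₀, x⃗)| ≤ K γ^h w_m` — summation by parts in `k₀` (`MatsubaraSummationByParts`)
against the `N`-th Matsubara differences of the slices. [cite: BenfattoGiulianiMastropietro2006, §2.5 proof of Lemma 2.2 (2.36c)/(2.52) p0010:L155–p0011:L7, Lemma 2.3 (2.60) p0011:L133–L140] -/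
theorem exists_dbetapow_mul_norm_bgmGenProp_le {μ e₀ : ℝ} (hμ₁ : -4 < μ) (he : 0 < e₀) (he4 : e₀ < μ + 4)
    (C : ℕ → ℝ) (N : ℕ) {c₀ : ℝ} (hc₁ : c₀ ≤ 1) :
    ∃ K : ℝ, 0 ≤ K ∧ ∀ (β U : ℝ) (hβ : ℤ) (E : ℤ → ℝ × (Fin 2 → ℝ) → ℂ), 0 < β →
      BGMInitial E → BGMSymmetry E → BGMSmoothness β U C hβ E → |U| ≤ c₀ → |U| * |(hβ : ℝ)| ≤ c₀ →
      |C 0| * c₀ ≤ 3 / 16 * e₀ → 2 * |C 1| * c₀ ^ 2 ≤ 1 / 2 →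
      2 * (4 * |C 2| * c₀ ^ 2) * (2 * |C 0| * c₀ + 2 * e₀) ≤ 1 →
      μ + e₀ + 2 * |C 0| * c₀ < -2 - Real.sqrt 2 → 2 * |C 0| * c₀ ≤ (μ + 4 - e₀) / 2 →
      2 * (2 * |C 1| * c₀ ^ 2) ≤ 2 / π * Real.sqrt ((μ + 4 - e₀) / 2) →
      ∀ h : ℤ, hβ ≤ h → h ≤ 0 → ∀ (m ω : ℕ), ω < sectorCount m →
      ∀ (x₀ : ℝ) (x : Fin 2 → ℤ),
      ((4 : ℝ) ^ h * |bgmDbeta β x₀|) ^ N * ‖bgmGenProp β e₀ μ E h m ω x₀ x‖ ≤ K * (4 : ℝ) ^ h * sectorWidth m := by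
  have hπ := Real.pi_pos
  obtain ⟨c, hc⟩ : ∃ c : ℝ, c = Real.sqrt ((μ + 4 - e₀) / 2) := ⟨_, rfl⟩
  have hcpos : 0 < c := by rw [hc]; exact Real.sqrt_pos.2 (by linarith)
  obtain ⟨Kt, hKt0, hKt⟩ := exists_norm_fwdDiff_sectorIntegrand_le (μ := μ) he C N hc₁
  obtain ⟨Λ₁, hΛ₁⟩ : ∃ Λ₁ : ℝ, Λ₁ = (N + 1) * (6 * (3 / 4) * (π / 4) * Kt * (2 * (e₀ / (2 / π * c)))) / (2 * π) ^ 2 :=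
    ⟨_, rfl⟩
  have hΛ₁0 : 0 ≤ Λ₁ := by rw [hΛ₁]; positivity
  refine ⟨8 * e₀ * (N + 4) / π * Λ₁, by positivity,
    fun β U hβ E hβpos hI hSy hS hU hUh hK₀ hK₁ hK₂' hgap hgap' hδ₁ h hh₁ hh₀ m ω hω x₀ x => ?_⟩
  have h4 : (0 : ℝ) < (4 : ℝ) ^ h := zpow_pos (by norm_num) _
  have h4N : (0 : ℝ) < (4 : ℝ) ^ ((N : ℤ) * h) := zpow_pos (by norm_num) _
  have hw := sectorWidth_pos m
  have hd0 : 0 ≤ |bgmDbeta β x₀| := abs_nonneg _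
  -- the Matsubara box
  obtain ⟨Kβ, hKβ⟩ : ∃ Kβ : ℕ, Kβ = ⌈8 * e₀ * (4 : ℝ) ^ h * β / (2 * π)⌉₊ := ⟨_, rfl⟩
  have hmem : ∀ j, |fermiMatsubara β j| ≤ 8 * e₀ * (4 : ℝ) ^ h → j ∈ Finset.Icc (-(Kβ : ℤ)) Kβ :=
    fun j hj => by rw [hKβ]; exact natAbs_le_of_abs_fermiMatsubara_le hβpos hj
  have hpFi : ∀ i, |(levelRadius (bgmEffDisp β E h) μ (sectorCenter m ω) • dir (sectorCenter m ω)) i| < π / 4 :=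
    abs_fermiPoint_apply_lt hI hS hh₁ hh₀ hU hUh he hgap hgap' he4 hδ₁ _
  rw [bgmGenProp_eq_sum hI hSy hS he hβpos hh₁ hh₀ hU hUh hK₀ hK₁ hK₂' m ω x₀ x hmem, norm_mul,
    Complex.norm_real, Real.norm_eq_abs, abs_of_pos (by positivity : (0 : ℝ) < 1 / β)]
  obtain ⟨G, hG⟩ : ∃ G : ℤ → ℂ, G = fun j =>
      (∫ k in zoneSq, Complex.exp (-(Complex.I * ((dot2 k (fun i => (x i : ℝ)) : ℝ) : ℂ))) *
        (((bgmSectorFn e₀ μ E h m ω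
            (fermiMatsubara β j, k + levelRadius (bgmEffDisp β E h) μ (sectorCenter m ω) •
              dir (sectorCenter m ω)) : ℝ) : ℂ) /
          bgmDenom μ E (h - 1)
            (fermiMatsubara β j, k + levelRadius (bgmEffDisp β E h) μ (sectorCenter m ω) •
              dir (sectorCenter m ω)))) / (((2 * π) ^ 2 : ℝ) : ℂ) := ⟨_, rfl⟩
  have hsumG : (∑ j ∈ Finset.Icc (-(Kβ : ℤ)) Kβ,
      Complex.exp (-(Complex.I * ((π * (2 * (j : ℝ) + 1) / β * x₀ : ℝ) : ℂ))) •
        ((∫ k in zoneSq, Complex.exp (-(Complex.I * ((dot2 k (fun i => (x i : ℝ)) : ℝ) : ℂ))) *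
          (((bgmSectorFn e₀ μ E h m ω
              (fermiMatsubara β j, k + levelRadius (bgmEffDisp β E h) μ (sectorCenter m ω) •
                dir (sectorCenter m ω)) : ℝ) : ℂ) /
            bgmDenom μ E (h - 1)
              (fermiMatsubara β j, k + levelRadius (bgmEffDisp β E h) μ (sectorCenter m ω) •
                dir (sectorCenter m ω)))) / (((2 * π) ^ 2 : ℝ) : ℂ))) =
      ∑ j ∈ Finset.Icc (-(Kβ : ℤ)) Kβ,
        Complex.exp (-(Complex.I * ((π * (2 * (j : ℝ) + 1) / β * x₀ : ℝ) : ℂ))) • G j := by rw [hG]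
  rw [hsumG]
  by_cases hex : ∃ (j : ℤ) (q : Fin 2 → ℝ), bgmShell e₀ μ E h (fermiMatsubara β j, q) ≠ 0
  · obtain ⟨j₁, q₁, hf₁⟩ := hex
    have hδ : 2 * π / β ≤ 16 * e₀ * (4 : ℝ) ^ h := by
      have h1 := abs_k0_lt_of_bgmShell_ne_zero hI hSy hS he hβpos hh₁ hh₀ hU hUh hK₀ hK₁ hK₂' hf₁
      have h2 := pi_div_le_abs_fermiMatsubara hβpos j₁
      have : 2 * π / β = 2 * (π / β) := by ring
      linarith
    have hδpos : 0 < 2 * π / β := by positivity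
    have hMt : ∀ (j₀ : ℤ) (q : Fin 2 → ℝ), ‖(fwdDiff (1 : ℤ))^[N] (fun j : ℤ =>
        ((bgmSectorFn e₀ μ E h m ω (fermiMatsubara β j, q) : ℝ) : ℂ) / bgmDenom μ E (h - 1) (fermiMatsubara β j, q)) j₀‖ ≤
        Kt * (2 * π / β) ^ N * ((4 : ℝ) ^ (-h) * (4 : ℝ) ^ (-((N : ℤ) * h))) :=
      fun j₀ q => hKt β U hβ E hβpos hI hS hU hUh hK₀ h hh₁ hh₀ hδ m ω j₀ q
    have hGz : ∀ j, j ∉ Finset.Icc (-(Kβ : ℤ)) Kβ → G j = 0 := fun j hj => by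
      rw [hG]
      exact slice_eq_zero_of_not_mem_Icc hI hSy hS he hβpos hh₁ hh₀ hU hUh hK₀ hK₁ hK₂' m ω x _ j (by rw [← hKβ]; exact hj)
    have hF1 := Literature.Analysis.Fourier.dbeta_pow_mul_norm_matsubara_sum_le hβpos N G hGz x₀
    -- the `N`-th differences of `G`
    have hΔ : ∀ j, ‖(fwdDiff (-1 : ℤ))^[N] G j‖ ≤ Λ₁ * (2 * π / β) ^ N * sectorWidth m * (4 : ℝ) ^ (-((N : ℤ) * h)) := by
      intro j
      rw [norm_fwdDiff_neg_one_iter, hG, fwdDiff_iter_div_const, norm_div, Complex.norm_real, Real.norm_eq_abs,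
        abs_of_pos (by positivity : (0 : ℝ) < (2 * π) ^ 2),
        fwdDiff_iter_sliceIntegral hS he hh₁ hh₀ hU hUh hK₀ m ω _ _ N (j - N)]
      have hb := norm_integral_fwdDiff_slice_le hI hS he hh₁ hh₀ hU hUh hμ₁ hK₀ hgap hgap' he4 hδ₁ hpFi m hω
        (fun i => (x i : ℝ)) N (by positivity) hMt (j - N)
      refine (div_le_div_of_nonneg_right hb (by positivity)).trans (le_of_eq ?_)
      rw [hΛ₁, hc, zpow_neg (4 : ℝ) h]
      field_simp
    -- the frequency count
    have hcard : ((Finset.Icc (-(Kβ : ℤ)) (Kβ + N)).card : ℝ) = 2 * Kβ + N + 1 := by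
      rw [Int.card_Icc, show (Kβ : ℤ) + N + 1 - -(Kβ : ℤ) = ((2 * Kβ + N + 1 : ℕ) : ℤ) by push_cast; ring,
        Int.toNat_natCast]
      push_cast; ring
    have hKβlt : (Kβ : ℝ) < 8 * e₀ * (4 : ℝ) ^ h * β / (2 * π) + 1 := by
      rw [hKβ]; exact Nat.ceil_lt_add_one (by positivity)
    have hinvβ : 1 / β ≤ 8 * e₀ * (4 : ℝ) ^ h / π := by
      rw [div_le_iff₀ hβpos] at hδ
      rw [div_le_div_iff₀ hβpos hπ]
      linarith
    have hcount : 1 / β * (2 * Kβ + N + 1 : ℝ) ≤ 8 * e₀ * (N + 4) / π * (4 : ℝ) ^ h := by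
      have h1 : 1 / β * (2 * (Kβ : ℝ)) ≤ 2 * (8 * e₀ * (4 : ℝ) ^ h) / (2 * π) + 2 * (1 / β) := by
        have : 1 / β * (2 * (Kβ : ℝ)) ≤ 1 / β * (2 * (8 * e₀ * (4 : ℝ) ^ h * β / (2 * π) + 1)) :=
          mul_le_mul_of_nonneg_left (by linarith) (by positivity)
        refine this.trans (le_of_eq ?_)
        field_simp
      have h2 : 1 / β * (2 * Kβ + N + 1 : ℝ) = 1 / β * (2 * (Kβ : ℝ)) + (N + 1) * (1 / β) := by ring
      rw [h2]
      have h3 : ((N : ℝ) + 1) * (1 / β) ≤ (N + 1) * (8 * e₀ * (4 : ℝ) ^ h / π) :=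
        mul_le_mul_of_nonneg_left hinvβ (by positivity)
      have h5 : 2 * (1 / β) ≤ 2 * (8 * e₀ * (4 : ℝ) ^ h / π) := by linarith
      calc 1 / β * (2 * (Kβ : ℝ)) + (N + 1) * (1 / β)
          ≤ 2 * (8 * e₀ * (4 : ℝ) ^ h) / (2 * π) + 2 * (8 * e₀ * (4 : ℝ) ^ h / π) +
            (N + 1) * (8 * e₀ * (4 : ℝ) ^ h / π) := by linarith
        _ = 8 * e₀ * (N + 4) / π * (4 : ℝ) ^ h := by field_simp; ring
    -- combine
    have hsum : (2 * π / β * |bgmDbeta β x₀|) ^ N *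
        ‖∑ j ∈ Finset.Icc (-(Kβ : ℤ)) Kβ,
          Complex.exp (-(Complex.I * ((π * (2 * (j : ℝ) + 1) / β * x₀ : ℝ) : ℂ))) • G j‖ ≤
        (2 * Kβ + N + 1 : ℝ) * (Λ₁ * (2 * π / β) ^ N * sectorWidth m * (4 : ℝ) ^ (-((N : ℤ) * h))) := by
      rw [bgmDbeta]
      refine hF1.trans ?_
      rw [← hcard, ← nsmul_eq_mul, ← Finset.sum_const]
      exact Finset.sum_le_sum fun j _ => hΔ j
    have hsum2 : (2 * π / β) ^ N * (|bgmDbeta β x₀| ^ N *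
        ‖∑ j ∈ Finset.Icc (-(Kβ : ℤ)) Kβ,
          Complex.exp (-(Complex.I * ((π * (2 * (j : ℝ) + 1) / β * x₀ : ℝ) : ℂ))) • G j‖) ≤
        (2 * π / β) ^ N * ((2 * Kβ + N + 1 : ℝ) * (Λ₁ * sectorWidth m * (4 : ℝ) ^ (-((N : ℤ) * h)))) := by
      calc (2 * π / β) ^ N * (|bgmDbeta β x₀| ^ N *
            ‖∑ j ∈ Finset.Icc (-(Kβ : ℤ)) Kβ,
              Complex.exp (-(Complex.I * ((π * (2 * (j : ℝ) + 1) / β * x₀ : ℝ) : ℂ))) • G j‖)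
          = (2 * π / β * |bgmDbeta β x₀|) ^ N *
            ‖∑ j ∈ Finset.Icc (-(Kβ : ℤ)) Kβ,
              Complex.exp (-(Complex.I * ((π * (2 * (j : ℝ) + 1) / β * x₀ : ℝ) : ℂ))) • G j‖ := by
            rw [mul_pow]; ring
        _ ≤ _ := hsum
        _ = _ := by ring
    have hsum' := le_of_mul_le_mul_left hsum2 (pow_pos hδpos N)
    have hNN : (4 : ℝ) ^ ((N : ℤ) * h) * (4 : ℝ) ^ (-((N : ℤ) * h)) = 1 := by
      rw [zpow_neg]; exact mul_inv_cancel₀ h4N.ne'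
    have hxN : ((4 : ℝ) ^ h * |bgmDbeta β x₀|) ^ N = (4 : ℝ) ^ ((N : ℤ) * h) * |bgmDbeta β x₀| ^ N := by
      rw [mul_pow, ← zpow_natCast, ← zpow_mul, mul_comm h]
    rw [hxN]
    calc (4 : ℝ) ^ ((N : ℤ) * h) * |bgmDbeta β x₀| ^ N * (1 / β * ‖∑ j ∈ Finset.Icc (-(Kβ : ℤ)) Kβ, _‖)
        = (4 : ℝ) ^ ((N : ℤ) * h) * (1 / β) * (|bgmDbeta β x₀| ^ N * ‖∑ j ∈ Finset.Icc (-(Kβ : ℤ)) Kβ, _‖) := by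
          ring
      _ ≤ (4 : ℝ) ^ ((N : ℤ) * h) * (1 / β) *
          ((2 * Kβ + N + 1 : ℝ) * (Λ₁ * sectorWidth m * (4 : ℝ) ^ (-((N : ℤ) * h)))) :=
          mul_le_mul_of_nonneg_left hsum' (by positivity)
      _ = ((4 : ℝ) ^ ((N : ℤ) * h) * (4 : ℝ) ^ (-((N : ℤ) * h))) * (1 / β * (2 * Kβ + N + 1 : ℝ)) *
          (Λ₁ * sectorWidth m) := by ring
      _ ≤ 1 * (8 * e₀ * (N + 4) / π * (4 : ℝ) ^ h) * (Λ₁ * sectorWidth m) := by rw [hNN]; gcongr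
      _ = 8 * e₀ * (N + 4) / π * Λ₁ * (4 : ℝ) ^ h * sectorWidth m := by ring
  · -- no slice is ever nonzero: the propagator vanishes
    push Not at hex
    have h0 : ∀ j, G j = 0 := fun j => by
      rw [hG]
      simp only [bgmSectorFn, hex, zero_mul, Complex.ofReal_zero, zero_div, mul_zero, integral_zero, zero_div]
    simp only [h0, smul_zero, Finset.sum_const_zero, norm_zero, mul_zero]
    positivity

end Time



/-! ### §4 Assembly: the decay bound for the general sector propagator and Lemma 2.3 -/

section Assembly

/-- `(a + b)^N ≤ 2^N (a^N + b^N)` for `a, b ≥ 0`. [folklore] -/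
private theorem add_pow_le_two_pow_mul {a b : ℝ} (ha : 0 ≤ a) (hb : 0 ≤ b) (N : ℕ) :
    (a + b) ^ N ≤ 2 ^ N * (a ^ N + b ^ N) := by
  have h1 : a + b ≤ 2 * max a b := by
    rcases le_total a b with h | h
    · rw [max_eq_right h]; linarith
    · rw [max_eq_left h]; linarith
  have h2 : (a + b) ^ N ≤ (2 * max a b) ^ N := pow_le_pow_left₀ (by positivity) h1 N
  have h3 : (max a b) ^ N ≤ a ^ N + b ^ N := by
    rcases le_total a b with h | h
    · rw [max_eq_right h]; linarith [pow_nonneg ha N]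
    · rw [max_eq_left h]; linarith [pow_nonneg hb N]
  rw [mul_pow] at h2
  exact h2.trans (mul_le_mul_of_nonneg_left h3 (by positivity))

/-- `√(x₀² + x₁²) ≤ |x₀| + |x₁|`. [folklore] -/
private theorem sqrt_sq_add_sq_le_abs_add_abs (a b : ℝ) : Real.sqrt (a ^ 2 + b ^ 2) ≤ |a| + |b| := by
  rw [Real.sqrt_le_left (by positivity)]
  nlinarith [abs_nonneg a, abs_nonneg b, sq_abs a, sq_abs b]

/-- The coupled-smallness constant may be taken `≤ 1`. [cite: BenfattoGiulianiMastropietro2006, §2.4 Lemma 2.1 (hypothesis) p0009:L39–L43] -/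
private theorem exists_coupledSmallness_le_one {μ e₀ : ℝ} (he₀ : BGMAdmissibleE0 μ e₀) (C : ℕ → ℝ) :
    ∃ c₀ : ℝ, 0 < c₀ ∧ c₀ ≤ 1 ∧ |C 0| * c₀ ≤ 3 / 16 * e₀ ∧ 2 * |C 1| * c₀ ^ 2 ≤ 1 / 2 ∧
      2 * (4 * |C 2| * c₀ ^ 2) * (2 * |C 0| * c₀ + 2 * e₀) ≤ 1 ∧
      μ + e₀ + 2 * |C 0| * c₀ < -2 - Real.sqrt 2 ∧
      2 * |C 0| * c₀ ≤ (μ + 4 - e₀) / 2 ∧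
      2 * (2 * |C 1| * c₀ ^ 2) ≤ 2 / π * Real.sqrt ((μ + 4 - e₀) / 2) := by
  have he : 0 < e₀ := he₀.1
  obtain ⟨c₀, hc₀, hK₀, hK₁, hK₂', hgap, hgap', hδ₁⟩ := exists_coupledSmallness he₀ C
  have hm0 : 0 < min c₀ 1 := lt_min hc₀ one_pos
  have hm1 : min c₀ 1 ≤ c₀ := min_le_left _ _
  have hm0' : 0 ≤ min c₀ 1 := hm0.le
  have hsq : (min c₀ 1) ^ 2 ≤ c₀ ^ 2 := pow_le_pow_left₀ hm0' hm1 2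
  refine ⟨min c₀ 1, hm0, min_le_right _ _, ?_, ?_, ?_, ?_, ?_, ?_⟩
  · exact (mul_le_mul_of_nonneg_left hm1 (abs_nonneg _)).trans hK₀
  · exact (mul_le_mul_of_nonneg_left hsq (by positivity)).trans hK₁
  · refine le_trans ?_ hK₂'
    gcongr
  · have := mul_le_mul_of_nonneg_left hm1 (by positivity : (0 : ℝ) ≤ 2 * |C 0|); linarith
  · exact (mul_le_mul_of_nonneg_left hm1 (by positivity)).trans hgap'
  · exact (mul_le_mul_of_nonneg_left (mul_le_mul_of_nonneg_left hsq (by positivity)) (by norm_num)).trans hδ₁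

/-- **The decay bound for the general single-scale sector propagator of a moving dispersion, every scale,
uniformly in `β`** — Lemmas 2.2/2.3 of BGM06 in the isotropic normal form: for `-4 < μ`, admissible `e₀`
and the constants `C` of (2.36) and every `N` there are `c₀ > 0` and `K` such that under `E_0 ≡ ε₀`, the
symmetry (2.36a) and the smoothness bounds (2.36) with `|h_β|U₀ ≤ c₀`, for every `h_β ≤ h ≤ 0`, every angular
index `m` with `γ^h ≤ w_m` (anisotropic `m = n`, isotropic `m = 2n`), every sector and every `(x₀, x⃗)`:
`|g(x₀, x⃗)| ≤ K γ^h w_m / (1 + (γ^h|d_β(x₀)| + γ^h|x⃗|))^N`. [cite: BenfattoGiulianiMastropietro2006, §2.5 Lemma 2.2 (2.52) p0010:L112–L120 and Lemma 2.3 (2.60) p0011:L133–L140] -/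
theorem exists_decay_bgmGenProp {μ e₀ : ℝ} (hμ₁ : -4 < μ) (he₀ : BGMAdmissibleE0 μ e₀) (C : ℕ → ℝ) (N : ℕ) :
    ∃ c₀ K : ℝ, 0 < c₀ ∧ 0 ≤ K ∧
    ∀ (β U₀ U : ℝ) (hβ : ℤ), 0 < β → hβ ≤ 0 → |U| ≤ U₀ → |(hβ : ℝ)| * U₀ ≤ c₀ →
    ∀ E : ℤ → ℝ × (Fin 2 → ℝ) → ℂ, BGMInitial E → BGMSymmetry E → BGMSmoothness β U C hβ E →
    ∀ h : ℤ, hβ ≤ h → h ≤ 0 → ∀ (m ω : ℕ), ω < sectorCount m → (4 : ℝ) ^ h ≤ sectorWidth m →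
    ∀ (x₀ : ℝ) (x : Fin 2 → ℤ),
      ‖bgmGenProp β e₀ μ E h m ω x₀ x‖ ≤ K * (4 : ℝ) ^ h * sectorWidth m /
        (1 + ((4 : ℝ) ^ h * |bgmDbeta β x₀| +
              (4 : ℝ) ^ h * Real.sqrt (((x 0 : ℝ)) ^ 2 + ((x 1 : ℝ)) ^ 2)) ^ N) := by
  obtain ⟨he, he2, he4⟩ := he₀
  have hπ := Real.pi_pos
  have hc0 : 0 < Real.sqrt ((μ + 4 - e₀) / 2) := Real.sqrt_pos.2 (by linarith)
  obtain ⟨c₀, hc₀pos, hc₁, hK₀, hK₁, hK₂', hgap, hgap', hδ₁⟩ := exists_coupledSmallness_le_one ⟨he, he2, he4⟩ C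
  obtain ⟨Ks, hKs0, hKs⟩ := exists_xpow_mul_norm_bgmGenProp_le hμ₁ he he4 C N hc₁
  obtain ⟨Kt, hKt0, hKt⟩ := exists_dbetapow_mul_norm_bgmGenProp_le hμ₁ he he4 C N hc₁
  obtain ⟨K₀, hK₀'⟩ : ∃ K₀ : ℝ, K₀ = 144 * e₀ / (π * Real.sqrt ((μ + 4 - e₀) / 2)) := ⟨_, rfl⟩
  have hK₀0 : 0 ≤ K₀ := by rw [hK₀']; positivity
  refine ⟨c₀, K₀ + 2 ^ N * (Kt + 2 ^ N * (Ks + Ks)), hc₀pos, by positivity,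
    fun β U₀ U hβ hβpos hhβ hU hc E hI hSy hS h hh₁ hh₀ m ω hω hwm x₀ x => ?_⟩
  obtain ⟨U', hS', hU', hUh'⟩ := bgmSmoothness_wlog hS hhβ hU hc hc₀pos.le
  have h4 : (0 : ℝ) < (4 : ℝ) ^ h := zpow_pos (by norm_num) _
  have hw := sectorWidth_pos m
  -- the three bounds
  have hb0 : ‖bgmGenProp β e₀ μ E h m ω x₀ x‖ ≤ K₀ * ((4 : ℝ) ^ h * sectorWidth m) := by
    rw [hK₀']
    have := norm_bgmGenProp_le_of_smallness hI hSy hS' he hβpos hh₁ hh₀ hU' hUh' hμ₁ hK₀ hK₁ hK₂' hgap hgap'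
      he4 hδ₁ m hω x₀ x
    refine this.trans (le_of_eq ?_)
    field_simp
  have hbt : ((4 : ℝ) ^ h * |bgmDbeta β x₀|) ^ N * ‖bgmGenProp β e₀ μ E h m ω x₀ x‖ ≤
      Kt * ((4 : ℝ) ^ h * sectorWidth m) := by
    rw [← mul_assoc]
    exact hKt β U' hβ E hβpos hI hSy hS' hU' hUh' hK₀ hK₁ hK₂' hgap hgap' hδ₁ h hh₁ hh₀ m ω hω x₀ x
  have hbs : ∀ i : Fin 2, ((4 : ℝ) ^ h * |(x i : ℝ)|) ^ N * ‖bgmGenProp β e₀ μ E h m ω x₀ x‖ ≤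
      Ks * ((4 : ℝ) ^ h * sectorWidth m) := fun i => by
    rw [← mul_assoc]
    exact hKs β U' hβ E hβpos hI hSy hS' hU' hUh' hK₀ hK₁ hK₂' hgap hgap' hδ₁ h hh₁ hh₀ m ω hω hwm x₀ x i
  -- combine
  obtain ⟨g, hg⟩ : ∃ g : ℝ, g = ‖bgmGenProp β e₀ μ E h m ω x₀ x‖ := ⟨_, rfl⟩
  have hg0 : 0 ≤ g := by rw [hg]; exact norm_nonneg _
  rw [← hg] at hb0 hbt hbs ⊢
  obtain ⟨a, ha⟩ : ∃ a : ℝ, a = (4 : ℝ) ^ h * |bgmDbeta β x₀| := ⟨_, rfl⟩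
  obtain ⟨b₀, hb₀⟩ : ∃ b₀ : ℝ, b₀ = (4 : ℝ) ^ h * |(x 0 : ℝ)| := ⟨_, rfl⟩
  obtain ⟨b₁, hb₁⟩ : ∃ b₁ : ℝ, b₁ = (4 : ℝ) ^ h * |(x 1 : ℝ)| := ⟨_, rfl⟩
  have ha0 : 0 ≤ a := by rw [ha]; positivity
  have hb₀0 : 0 ≤ b₀ := by rw [hb₀]; positivity
  have hb₁0 : 0 ≤ b₁ := by rw [hb₁]; positivity
  rw [← ha] at hbt ⊢
  have hbs0 := hbs 0
  have hbs1 := hbs 1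
  rw [← hb₀] at hbs0
  rw [← hb₁] at hbs1
  obtain ⟨W, hW⟩ : ∃ W : ℝ, W = (4 : ℝ) ^ h * sectorWidth m := ⟨_, rfl⟩
  have hW0 : 0 < W := by rw [hW]; positivity
  rw [← hW] at hb0 hbt hbs0 hbs1
  -- `(4^h |x|) ≤ b₀ + b₁`
  have hxle : (4 : ℝ) ^ h * Real.sqrt (((x 0 : ℝ)) ^ 2 + ((x 1 : ℝ)) ^ 2) ≤ b₀ + b₁ := by
    rw [hb₀, hb₁, ← mul_add]
    exact mul_le_mul_of_nonneg_left (sqrt_sq_add_sq_le_abs_add_abs _ _) h4.le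
  have hden_le : (a + (4 : ℝ) ^ h * Real.sqrt (((x 0 : ℝ)) ^ 2 + ((x 1 : ℝ)) ^ 2)) ^ N ≤
      (a + (b₀ + b₁)) ^ N :=
    pow_le_pow_left₀ (by positivity) (by linarith) N
  rw [le_div_iff₀ (by positivity)]
  have h1 : (a + (b₀ + b₁)) ^ N ≤ 2 ^ N * (a ^ N + 2 ^ N * (b₀ ^ N + b₁ ^ N)) := by
    have s2 := add_pow_le_two_pow_mul ha0 (by positivity : 0 ≤ b₀ + b₁) N
    have s3 := add_pow_le_two_pow_mul hb₀0 hb₁0 N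
    calc (a + (b₀ + b₁)) ^ N ≤ 2 ^ N * (a ^ N + (b₀ + b₁) ^ N) := s2
      _ ≤ 2 ^ N * (a ^ N + 2 ^ N * (b₀ ^ N + b₁ ^ N)) := by gcongr
  calc g * (1 + (a + (4 : ℝ) ^ h * Real.sqrt (((x 0 : ℝ)) ^ 2 + ((x 1 : ℝ)) ^ 2)) ^ N)
      = g + g * (a + (4 : ℝ) ^ h * Real.sqrt (((x 0 : ℝ)) ^ 2 + ((x 1 : ℝ)) ^ 2)) ^ N := by ring
    _ ≤ g + g * (2 ^ N * (a ^ N + 2 ^ N * (b₀ ^ N + b₁ ^ N))) := by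
        have := mul_le_mul_of_nonneg_left (hden_le.trans h1) hg0
        linarith
    _ = g + 2 ^ N * (a ^ N * g + 2 ^ N * (b₀ ^ N * g + b₁ ^ N * g)) := by ring
    _ ≤ K₀ * W + 2 ^ N * (Kt * W + 2 ^ N * (Ks * W + Ks * W)) := by gcongr
    _ = (K₀ + 2 ^ N * (Kt + 2 ^ N * (Ks + Ks))) * (4 : ℝ) ^ h * sectorWidth m := by rw [hW]; ring

/-- **Lemma 2.3 of BGM06, (2.60)** — the decay of the isotropic single-scale propagators `ḡ^{(h)}_ω̄` for the
scale-dependent dispersion: `|ḡ^{(h)}_ω̄(x)| ≤ C_N γ^{2h}/(1 + (γ^h|d_β(x₀)| + γ^h|x⃗|)^N)`, uniformly in `β`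
(the isotropic sectors have angular width `πγ^h`). [cite: BenfattoGiulianiMastropietro2006, §2.5 Lemma 2.3 (2.60) p0011:L133–L140] -/
theorem BGM2006_Lemma_2_3_holds : BGM2006_Lemma_2_3 := by
  intro μ e₀ hμ₁ _ he₀ C N
  obtain ⟨c₀, K, hc₀, hK0, hmain⟩ := exists_decay_bgmGenProp hμ₁ he₀ C N
  refine ⟨c₀, K * π, hc₀, fun β U₀ U hβ hβpos hhβ hU hc E hI hSy hS h hh₁ hh₀ ω hω x₀ x => ?_⟩
  have hπ := Real.pi_pos
  have h4 : (0 : ℝ) < (4 : ℝ) ^ h := zpow_pos (by norm_num) _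
  have hwidth := sectorWidth_two_mul_bgmScaleIdx hh₀
  have hwm : (4 : ℝ) ^ h ≤ sectorWidth (2 * bgmScaleIdx h) := by
    rw [hwidth]
    have : (1 : ℝ) * (4 : ℝ) ^ h ≤ π * (4 : ℝ) ^ h :=
      mul_le_mul_of_nonneg_right (by linarith [Real.pi_gt_three]) h4.le
    linarith
  have hb := hmain β U₀ U hβ hβpos hhβ hU hc E hI hSy hS h hh₁ hh₀ (2 * bgmScaleIdx h) ω hω hwm x₀ x
  rw [hwidth] at hb
  refine hb.trans (le_of_eq ?_)
  rw [show (4 : ℝ) ^ (2 * h) = (4 : ℝ) ^ h * (4 : ℝ) ^ h by rw [two_mul, zpow_add₀ (by norm_num)]]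
  ring

end Assembly

end Literature.MathematicalPhysics.QuantumLattice.FermiRG

end
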